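import Mathlib
import Literature.NumberTheory.LFunctions.Zhang2022.Section14MeanSquareMajorant

/-!
# Zhang (2022) §§15–17: mean-square majorants at the `Ψ₁ → Ψ` extension sites (15.4), (17.2), (17.7)

Trunk T-ANT (NumberTheory/LFunctions). Y. Zhang, *Discrete mean estimates and the Landau–Siegel
zero*, arXiv:2211.02515v1 (2022) [Zhang2022LandauSiegel], §15 ((15.1), (15.2), (15.4)) [p. 30 of the
source], §17 ((17.1)–(17.3), (17.7)–(17.8) and the definitions of `ν*`, `𝒦₃*`, `ν₁*`, `ϱ*`) [p. 35],
with §3 (`ν`, `υ`, (3.1), `F`, `G`) [p. 7], §6 (Lemma 6.1: `K`, `N`, `g*`, `P₄`, `T`) [p. 12], §12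
((12.1), (12.2)) [p. 24] and (2.13), (2.21)–(2.27) [pp. 5–6]. **Status of the source: an unrefereed
manuscript, a claimed result under adjudication** (cell pub-zhang: audit + repair census of
arXiv:2211.02515; no claim about Landau–Siegel). This file is the third of the cell's ALT-seat-3
majorant files, after `Zhang2022.Section7MeanSquareMajorant` ((7.5): exponent `9`) and
`Zhang2022.Section14MeanSquareMajorant` ((14.3) at its call sites (15.5), (16.1): exponent `9`; the
printed `τ_j` counts), whose module docstring lists as "deliberately NOT here" exactly "the further
`Ψ₁ → Ψ` extension sites (15.4), (17.2), (17.7) of the source" treated below.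

The source. (15.4) [p. 30]: "For `σ < 0` we can write
`L(1−s−β₁,ψ̄)L(1−s−β₂,ψ̄)K(1−s−β₃,ψ̄)/L(1−s,ψ̄) = ∑_m k̃(m)ψ̄(m)/m^{1−s}` with `k̃(m) ≪ τ₄(m)`. Hence,
moving the segment `𝒥(−α)` to `𝒥(−1)` with a negligible error, we find that
`∑_{ψ∈Ψ₁} I₂⁻(ψ) = τ(χ)∑_{ψ∈Ψ₁} χ(p_ψ)(p_ψt₀)^{−β₃}·(1/2πi)∫_{𝒥(−1)} (∑_m k̃(m)ψ̄(Dm)/(Dm)^{1−s}) B(s,ψ)ω(s) ds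
+ o(𝔓)`. In a way similar to the proof of (7.3), the sum over `ψ ∈ Ψ₁` can be extended to the sum
over `ψ ∈ Ψ`, … with acceptable errors." Here `K(s,ψ) = ∑_n ψ(n)n^{−s}g*(P₄/n)` (Lemma 6.1 [p. 12];
`g*(y) = g(y)` for `y > 1/2`, `0` otherwise), the shifts `β_j` are purely imaginary (2.13), and
`B(s,ψ) = ∑_n b(n)(ψχ)(n)n^{−s}` (15.1) with "`b(n) ≪ τ₂(n)`, `b(n) = 0` if `n > PT^{−2}η₊`" (15.2).
(17.2) [p. 35]: "To treat the sum of `I₄⁺(ψ)` we move the segment `𝒥(α)` to `𝒥(1)`, and then extend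
the sum over `Ψ₁` to the sum over `Ψ` with an acceptable error. Hence (17.2)", the integrand being
`𝒦₃(s,ψ)ω(s)` with "`(L(s+β₁,ψ)/L(s,ψ))B(s,ψ)G(s,ψ)N(s+β₂,ψ)N(s+β₃,ψ) = ∑_m ν*(m)ψ(m)m^{−s}`" and
"`ν*(n) = ∑_{n=n₁⋯n₆} κ₂(n₁)χ(n₂n₃)(𝔨₁(n₂)+ι₂𝔨₂(n₂))(ῑ₃𝔨₃(n₃)+ῑ₄𝔨₄(n₃))υ(n₄)g̃₂(n₅)g̃₃(n₆)`".
(17.7) [p. 35]: "`𝒦₃*(ψ) = (L(1−s−β₁,ψ̄)/L(1−s,ψ̄))F(1−s,ψ̄)B(s,ψ)G(s,ψ)N(s+β₂,ψ)N(s+β₃,ψ)`. Moving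
the segment `𝒥(−α)` to `𝒥(−1)` and then extend the sum over `Ψ₁` to then sum over `Ψ` we obtain
(17.7)", then "`G(s,ψ)N(s+β₂,ψ)N(s+β₃,ψ) = ∑_l ν₁*(l)ψ(l)l^{−s}`, so that
`B(s,ψ)G(s,ψ)N(s+β₂,ψ)N(s+β₃,ψ) = ∑_n (b∗ν₁*)(n)ψ(n)n^{−s}`", "`L(1−s−β₁,ψ̄)/L(1−s,ψ̄) =
∑_m κ̄₂(m)ψ̄(m)/m^{1−s}` with `κ̄₂(m) = conj κ₂(m)`", "`ϱ*(n) = ∑_{n=lm, l<D⁴} ν(l)κ̄₂(m)`" and "the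
arithmetic function `(b∗ν₁*)(n)` is supported on `n < PT^{−2}`". Throughout,
`F(s,ψ) = ∑_{n≤D⁴} ν(n)ψ(n)n^{−s}`, `G(s,ψ) = ∑_{n≤D⁴} υ(n)ψ(n)n^{−s}` [p. 7], where
`ζ(s)L(s,χ) = ∑_n ν(n)n^{−s}`, `ζ(s)^{−1}L(s,χ)^{−1} = ∑_n υ(n)n^{−s}` and "It is easy to see that
`|υ(n)| ≤ ν(n) ≤ τ₂(n)` (3.1)"; `N(s,ψ) = ∑_n ψ(n)n^{−s}g*(T²/n)` [p. 12] (so supported on `n < 2T²`),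
`T = exp{𝓛^{1.1}}` [p. 12], `P = exp{𝓛⁹}` (2.6); `B = (H₁₄ + ι₂H₁₂)H₂` (12.2) with `H₁₄ = ∑_{n<P^{1/2}}`
(12.1), `H₂ = ῑ₃H₁₃ + ῑ₄H₁₂` (2.27), `H₁₂`, `H₁₃` of lengths `P₂ = P^{1/2}T^{−10}`, `P₃ = P^{0.498}`
(2.21), (2.24)–(2.25), all with coefficients `(1 − log n/log P_j)(P_j/n)^{β}(ψχ)(n)` of modulus `≤ 1`.

As at (7.5) and (14.3), what such an extension step reads off the coefficient sequences is a pair of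
logarithmic mean squares `∑_{n≤X} |·(n)|²/n` — of the `L`-ratio-side sequence (`k̃`; `ν*`; `ϱ*`) and
of the self-convolution of the opposite Dirichlet polynomial (`b ⋆ b`; `F`-coefficients `⋆` themselves;
`Q ⋆ Q` with `Q = b ∗ ν₁*`), or, in the other order of the Cauchy–Schwarz step at (17.7), of `Q` and of
`ϱ* ⋆ ϱ*`. In the cell's bookkeeping (ALT-3 §B10) these are the five SITE ROWS X-ALT3.15.04a/b,
X-ALT3.17.02a, X-ALT3.17.07a/b of the fragment `HOME/b2b-zhang-alt-3-g3/alt3_rows_v6.json`, whose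
`μ`-counts — `4e_P | 16e_P` at (15.4), `4e_P + 12e_T + 20s | 16s` at (17.2), `4s | 16e_P + 48e_T + 80s`
and `4e_P + 12e_T + 20s | 16s` at (17.7) — were so far BY-HAND counts ("holds-with-literature-input";
`HOME/code/b2b-zhang-alt-3/alt3_exponent_floor.py`); `e_P`, `e_T`, `s = sSplit` are the cell's units
for a factor `log` of a `P`-power length, of a `T`-power length, and for the split-prime sum `S`.
This file proves those counts as theorems about arbitrary sequences of the quoted SHAPES.

## What this file PROVES (elementary: Hall–Tenenbaum (0.4) [HallTenenbaum1988] + Chebyshev–Mertens, as in the two companions)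

* THE ENGINE WITH THE PRIME SUM LEFT FREE: `sum_div_le_exp_sum : ∑_{n≤X} f(n)/n ≤ exp(∑_{p≤X} f(p)/p
  + S_d)` for `f ≥ 0` multiplicative with `f(p^ν) ≤ (ν+1)^d` — the first half of the proof of the §7
  file's `sum_div_le`, stopped before Mertens, so that SUPPORT and SPLITTING information can be fed
  into `∑_p f(p)/p`; the piecewise prime sum `sum_pw_div_prime_le : ∑_{p≤X} (e₀ + e₁[p≤y₁] + e₂[p≤y₂]
  + c[p≤y₀]s(p) + K log p)/p ≤ e₀(log log X + 4) + e₁(log log y₁ + 4) + e₂(log log y₂ + 4) + c·S +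
  K(log X + log 4)`, where the SPLIT SUM `splitSum s y₀ X = S = ∑_{p≤X, p≤y₀} s(p)/p` is kept as a
  symbol (`splitSum_le : S ≤ log log y₀ + 4` unconditionally; its smallness under the source's
  hypothesis (A) is the cell's `sSplit`, not asserted here); packaged as `sum_sq_div_le_scaleBound :
  ∑_{n≤X} G(n)²/n ≤ scaleBound e₀ e₁ e₂ c (2d) K s y₀ y₁ y₂ X := majorantConst (e₀+e₁+e₂) (2d) ·
  e^{K log 4X} · e^{c·S} · (log X)^{e₀}(log y₁)^{e₁}(log y₂)^{e₂}` (`X, y₁, y₂ ≥ 2`); and the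
  two-parameter form of the §7 count, `sum_sq_div_le_gen` (`g(p) ≤ m + B log p`, `g(p) ≤ m + M` ⇒
  exponent `m²`, middle factor `e^{(2m+M)B log 4X}`; the §7 file hard-codes `m = 3`, `M = 2`).
* MAJORANT ALGEBRA: blocks `IsBlock g c` (multiplicative, `≥ 0`, `g(p^i) ≤ (i+1)^c`), closed under
  Dirichlet product (`IsBlock.mul`, degrees add `+1`; `IsBlock.mul_prime : (g₁∗g₂)(p) = g₁(p) + g₂(p)`)
  and under pointwise product with the SMOOTH INDICATOR `smoothIndLE y` (`= 1` iff every prime factor is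
  `≤ y`; multiplicative; `smoothIndLE_prime : = [p ≤ y]`; `smoothIndLE_eq_one_of_le : = 1` on `1 ≤ n ≤ y`);
  DOMINATION `Dom u C g : |u(n)| ≤ C g(n)` (`n ≥ 1`) with `dom_seqConv : u ≪ C₁g₁, v ≪ C₂g₂ ⇒ u ⋆ v ≪
  C₁C₂ (g₁ ∗ g₂)`, `dom_smoothIndLE_of_support` (bounded and supported on `n ≤ y` ⇒ `≪ C·smoothIndLE y` —
  this is how a SHORT factor contributes `log log y` and not `log log X`), `dom_of_norm_le` (conjugates,
  unimodular twists `ψ(n)n^{−β}u(n)`); `sum_norm_sq_div_le_of_dom : u ≪ C·G`, `G` a block ⇒ `∑ |u|²/n ≤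
  C² · scaleBound …`.
* THE `ν`-TYPE INTERFACE AND ITS CONSTRUCTION (no existence smuggled into the interface): `IsNuType ν s`
  (`ν ≥ 0` multiplicative, `ν(p) ≤ 2s(p)`, `0 ≤ s ≤ 1`, `ν(p^i) ≤ i+1`) and `isNuType_nuChi :
  IsNuType (1 ∗ χ) (p ↦ (1 + χ(p))/2)` for every `{0,±1}`-valued completely multiplicative `χ : ℕ → ℝ`
  with `χ(1) = 1` (a real Dirichlet character read on `ℕ`): `nuChi_nonneg` is (3.1)'s `0 ≤ ν` — the one
  place where `χ` REAL is used — and `IsNuType.pow_le` its `ν ≤ τ₂` at prime powers; `s(p) = 1` at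
  split, `0` at inert, `1/2` at ramified primes.
* THE PRIME INEQUALITIES behind the counts: `nested_sq_le : (2a + 2b + xc)² ≤ 4a + 12b + 20cs` for
  `a, b, c ∈ {0,1}`, `c ≤ b ≤ a`, `0 ≤ x ≤ 2s ≤ 2`; `sq_mul_cut_le : (xc)² ≤ 4cs`; and the §1-style
  `sq_le_add` (a `κ_j` factor adds `(2m+M)·B log p`, absorbed into `e^{K log 4X}`).
* THE BLOCKS OF THE SOURCE with SHAPE ⇒ DOMINATION lemmas and prime values: `blockF ν y₀ = ν·[y₀-smooth]`
  (`F`, `G`, `y₀ = D⁴`; `dom_blockF`), `blockRho = blockF ∗ |κ₂|` (`ϱ*`; `dom_blockRho`),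
  `blockQ = (τ₂·[y_b-smooth]) ∗ blockF ∗ [y₂-smooth] ∗ [y₂-smooth]` (`Q = b ∗ ν₁*`; `dom_blockQ`),
  `blockNuStar = |κ₂| ∗ [y₁-smooth] ∗ [y₁-smooth] ∗ blockF ∗ [y₂-smooth] ∗ [y₂-smooth]` (`ν*`;
  `dom_blockNuStar`).
* THE EIGHT MEAN SQUARES (`X ≥ 2`; `C` = the product of the sup-norm constants; nesting of the cutoffs
  `y₀ ≤ y₂ ≤ y₁` resp. `≤ y_b` — in the source `D⁴ ≤ 2T² ≤ P^{1/2}`, `PT^{−2}η₊`, true for `𝓛` large):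
  (15.4): `sum_norm_kappa₁_conv_bounded_sq_div_le` — `k̃ = κ₁ ⋆ k`, `|k| ≤ C` ⇒ `≤ C² · majorantConst 4 8
  · e^{6(|b₁|+|b₂|) log 4X} · (log X)^4` [cell: `4e_P`; printed `τ₄`: `16`], and
  `sum_norm_seqConv_tau_two_sq_div_le` — `|b| ≤ Cτ₂` ⇒ `∑ |b⋆b|²/n ≤ C⁴ · majorantConst 16 8 · (log X)^{16}`
  [`16e_P`]. (17.2): `sum_norm_sq_div_le_of_dom_blockNuStar` — `u ≪ C·blockNuStar` ⇒ `≤ C² · scaleBound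
  0 4 12 20 14 (14|b₁|) s y₀ y₁ y₂ X`, i.e. `e^{14|b₁| log 4X} e^{20S} (log y₁)^4 (log y₂)^{12}`
  [`4e_P + 12e_T + 20s`; printed-style `τ₈`: `64`], and `sum_norm_seqConv_sq_div_le_of_dom_blockF` —
  `u ≪ C·blockF` ⇒ `∑ |u⋆u|²/n ≤ C⁴ · majorantConst 0 6 · e^{16S}` [`16s`]. (17.7):
  `sum_norm_sq_div_le_of_dom_blockRho` — `u ≪ C·blockRho` ⇒ `≤ C² · majorantConst 0 6 · e^{6|b₁| log 4X}
  · e^{4S}` [`4s`; `τ₄`: `16`] with `sum_norm_seqConv_sq_div_le_of_dom_blockQ` — `u ≪ C·blockQ` ⇒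
  `∑ |u⋆u|²/n ≤ C⁴ · scaleBound 0 16 48 80 26 0 s y₀ y_b y₂ X` [`16e_P + 48e_T + 80s`; `τ₁₂`: `144`]
  (the text's order), and `sum_norm_sq_div_le_of_dom_blockQ` — `≤ C² · scaleBound 0 4 12 20 12 0 …`
  [`4e_P + 12e_T + 20s`; `τ₆`: `36`] with `sum_norm_seqConv_sq_div_le_of_dom_blockRho` — `∑ |u⋆u|²/n ≤
  C⁴ · majorantConst 0 14 · e^{24|b₁| log 4X} · e^{16S}` [`16s`] (the other order).

Numbers, not adjectives: the constants `majorantConst e d = exp(4e + S_d)` are absurd as numbers,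
`X`-independent and not optimised; with the source's normalisation `α log P² = 2π` (2.10) and (2.13)
(`|b₁| log P² ≤ 2π`, `(|b₁|+|b₂|) log P² ≤ 6π`) the factors `e^{K log 4X}` are `O(1)` for `X ≤ P²`
(cf. the companions' `…_of_mul_log_le`). Only the EXPONENTS — of `log X`, `log y_i`, and the
coefficient of `S` — are what the cell's exponent layer reads, and they coincide with the by-hand
`μ`-counts at the five site rows. The mechanism: at a prime, a block takes the SUM of its factors'
prime values (`IsBlock.mul_prime`); a factor supported on `n ≤ y` contributes `[p ≤ y]`
(`smoothIndLE_prime`), a `ν`-type factor `ν(p) ≤ 2s(p)`, a `κ₂` factor `|κ₂(p)| ≤ |b₁| log p`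
(`Section14MeanSquareMajorant.norm_kappa₂_prime_le`), and `τ_j` contributes `j`.

Scope (deliberately NOT here): the extension steps themselves (Cauchy–Schwarz, the large sieve
Lemma 3.3 (ii), Proposition 2.1 for `#Ψ₂`; `Section3MeanValues`) and whether the manuscript's "in a way
similar to the proof of (7.3)" arguments at (15.4), (17.2), (17.7) go through — the cell's question
(rows X-15.04 / X-17.02 / X-17.07 and their ALT-3 twins); the lengths of the polynomials as functions
of `P` (the rows' `λ`) and the sizes of `log log y_i` in the units `e_P`, `e_T`; hypothesis (A) and the
size of `S` under it; the identities `L(1−s−β₁)L(1−s−β₂)K/L = ∑ k̃ …`, `… = ∑ ν* …` as `LSeries`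
statements — every theorem is stated for ARBITRARY sequences of the quoted shapes (`κ₁ ⋆ (bounded)`,
`|k| ≤ |κ₂|`, `|u| ≤ Cν` supported on `n ≤ y₀`, bounded supported on `n ≤ y`, `|b| ≤ Cτ₂` supported on
`n ≤ y_b`), which is all the counts use; and anything bearing on the cell's verdict on (8.24)/(2.32)
(`Section8Certificate.not_ineq824`). No statement about Theorems 1–2 of the source is made or implied.
-/

noncomputable section

open Finset Real ArithmeticFunction

namespace Literature.NumberTheory.LFunctions.Zhang2022.MeanSquareMajorant

/-! ### Part 1. The Euler-product majorant with a free prime sum -/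

variable {f : ℕ → ℝ}

/-- **The Euler-product majorant, prime sum left free.** Let `f ≥ 0` be multiplicative
(`f 1 = 1`, `f(mn) = f(m)f(n)` for coprime `m, n`) with `f(p^ν) ≤ (ν+1)^d` at prime powers. Then
for every `X`, `∑_{n≤X} f(n)/n ≤ exp(∑_{p≤X} f(p)/p + S_d)` with `S_d = LogEulerProduct.tailConst d`
(Hall–Tenenbaum (0.4) `∑_{n≤X} f(n)/n ≤ ∏_{p≤X} ∑_ν f(p^ν)/p^ν`, each local factor
`≤ exp(f(p)/p + S_d/p²)`, `∑_p 1/p² ≤ 1`). This is the first half of the proof of `sum_div_le`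
(§7 file), stopped before Mertens' theorems are applied, so that SUPPORT information on the factors
(`f(p)` vanishing for `p > y`) can be fed into the prime sum.
[cite: HallTenenbaum1988, (0.4) (§0.2, book p. 2)] -/
theorem sum_div_le_exp_sum (hf1 : f 1 = 1) (hmul : ∀ m n, Nat.Coprime m n → f (m * n) = f m * f n)
    (hf0 : ∀ n, 0 ≤ f n) {d : ℕ}
    (hfpow : ∀ p ν : ℕ, p.Prime → f (p ^ ν) ≤ ((ν : ℝ) + 1) ^ d) (X : ℕ) :
    ∑ n ∈ Icc 1 X, f n / n ≤
      Real.exp (∑ p ∈ Nat.primesLE X, f p / p + LogEulerProduct.tailConst d) := by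
  -- termwise bound of the local series: `f(p^ν)/p^ν ≤ (ν+1)^d 2^{-ν}`
  have hterm : ∀ p ν : ℕ, p.Prime → f (p ^ ν) / (p : ℝ) ^ ν ≤ ((ν : ℝ) + 1) ^ d * (1 / 2 : ℝ) ^ ν := by
    intro p ν hp
    have hp2 : (2 : ℝ) ≤ p := by exact_mod_cast hp.two_le
    have hppos : (0 : ℝ) < (p : ℝ) ^ ν := by positivity
    rw [div_le_iff₀ hppos]
    have h1 : (1 : ℝ) ≤ (1 / 2 : ℝ) ^ ν * (p : ℝ) ^ ν := by
      rw [← mul_pow]; exact one_le_pow₀ (by linarith)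
    calc f (p ^ ν) ≤ ((ν : ℝ) + 1) ^ d := hfpow p ν hp
      _ ≤ ((ν : ℝ) + 1) ^ d * ((1 / 2 : ℝ) ^ ν * (p : ℝ) ^ ν) :=
          le_mul_of_one_le_right (by positivity) h1
      _ = ((ν : ℝ) + 1) ^ d * (1 / 2 : ℝ) ^ ν * (p : ℝ) ^ ν := by ring
  -- hence each local series converges
  have hsum : ∀ p, p.Prime → Summable (fun ν : ℕ => f (p ^ ν) / (p : ℝ) ^ ν) := by
    intro p hp
    refine Summable.of_nonneg_of_le (fun ν => div_nonneg (hf0 _) (by positivity))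
      (fun ν => (hterm p ν hp).trans ?_) (LogEulerProduct.summable_tailConst d)
    exact mul_le_mul_of_nonneg_right
      (pow_le_pow_left₀ (by positivity) (by linarith) d) (by positivity)
  -- the tail `ν ≥ 2`: termwise `f(p^{i+2})/p^{i+2} ≤ (i+3)^d 2^{-i} / p²`
  have hterm2 : ∀ p i : ℕ, p.Prime →
      f (p ^ (i + 2)) / (p : ℝ) ^ (i + 2) ≤ ((i : ℝ) + 3) ^ d * (1 / 2 : ℝ) ^ i / (p : ℝ) ^ 2 := by
    intro p i hp
    have hp2 : (2 : ℝ) ≤ p := by exact_mod_cast hp.two_le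
    rw [div_le_div_iff₀ (by positivity) (by positivity)]
    have h1 : f (p ^ (i + 2)) ≤ ((i : ℝ) + 3) ^ d := by
      have h := hfpow p (i + 2) hp
      have e : ((↑(i + 2) : ℝ) + 1) = (i : ℝ) + 3 := by push_cast; ring
      rwa [e] at h
    have h2 : (p : ℝ) ^ 2 ≤ (1 / 2 : ℝ) ^ i * (p : ℝ) ^ (i + 2) := by
      rw [pow_add, ← mul_assoc, ← mul_pow]
      exact le_mul_of_one_le_left (by positivity) (one_le_pow₀ (by linarith))
    calc f (p ^ (i + 2)) * (p : ℝ) ^ 2 ≤ ((i : ℝ) + 3) ^ d * (p : ℝ) ^ 2 :=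
          mul_le_mul_of_nonneg_right h1 (by positivity)
      _ ≤ ((i : ℝ) + 3) ^ d * ((1 / 2 : ℝ) ^ i * (p : ℝ) ^ (i + 2)) :=
          mul_le_mul_of_nonneg_left h2 (by positivity)
      _ = ((i : ℝ) + 3) ^ d * (1 / 2 : ℝ) ^ i * (p : ℝ) ^ (i + 2) := by ring
  have htail : ∀ p, p.Prime →
      ∑' i : ℕ, f (p ^ (i + 2)) / (p : ℝ) ^ (i + 2) ≤ LogEulerProduct.tailConst d / (p : ℝ) ^ 2 := by
    intro p hp
    have hs1 := (summable_nat_add_iff (f := fun ν : ℕ => f (p ^ ν) / (p : ℝ) ^ ν) 2).mpr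
      (hsum p hp)
    have hs2 : Summable (fun i : ℕ => ((i : ℝ) + 3) ^ d * (1 / 2 : ℝ) ^ i / (p : ℝ) ^ 2) :=
      (LogEulerProduct.summable_tailConst d).div_const _
    calc ∑' i : ℕ, f (p ^ (i + 2)) / (p : ℝ) ^ (i + 2)
        ≤ ∑' i : ℕ, ((i : ℝ) + 3) ^ d * (1 / 2 : ℝ) ^ i / (p : ℝ) ^ 2 :=
          Summable.tsum_le_tsum (fun i => hterm2 p i hp) hs1 hs2
      _ = LogEulerProduct.tailConst d / (p : ℝ) ^ 2 := by rw [tsum_div_const]; rfl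
  -- each local factor: `∑_ν f(p^ν)/p^ν = 1 + f(p)/p + T_p ≤ exp(f(p)/p + S_d/p²)`
  have hloc : ∀ p, p.Prime →
      ∑' ν : ℕ, f (p ^ ν) / (p : ℝ) ^ ν ≤ Real.exp (f p / p + LogEulerProduct.tailConst d / (p : ℝ) ^ 2) := by
    intro p hp
    have hsplit := (hsum p hp).sum_add_tsum_nat_add 2
    have h2 : ∑ i ∈ range 2, f (p ^ i) / (p : ℝ) ^ i = 1 + f p / p := by
      simp [Finset.sum_range_succ, hf1]
    rw [← hsplit, h2]
    have ht := htail p hp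
    calc 1 + f p / p + ∑' i : ℕ, f (p ^ (i + 2)) / (p : ℝ) ^ (i + 2)
        ≤ (f p / p + LogEulerProduct.tailConst d / (p : ℝ) ^ 2) + 1 := by linarith
      _ ≤ _ := Real.add_one_le_exp _
  have hprod : ∏ p ∈ Nat.primesLE X, ∑' ν : ℕ, f (p ^ ν) / (p : ℝ) ^ ν ≤
      Real.exp (∑ p ∈ Nat.primesLE X, (f p / p + LogEulerProduct.tailConst d / (p : ℝ) ^ 2)) := by
    rw [Real.exp_sum]
    exact prod_le_prod (fun p _ => tsum_nonneg fun ν => div_nonneg (hf0 _) (by positivity))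
      fun p hp => hloc p (Nat.mem_primesLE.1 hp).2
  -- `∑_{p≤X} S_d/p² ≤ S_d`
  have htailsum :
      ∑ p ∈ Nat.primesLE X, LogEulerProduct.tailConst d / (p : ℝ) ^ 2 ≤ LogEulerProduct.tailConst d := by
    have hS := LogEulerProduct.tailConst_nonneg d
    calc ∑ p ∈ Nat.primesLE X, LogEulerProduct.tailConst d / (p : ℝ) ^ 2
        = LogEulerProduct.tailConst d * ∑ p ∈ Nat.primesLE X, 1 / (p : ℝ) ^ 2 := by
          rw [mul_sum]; exact sum_congr rfl fun p _ => by ring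
      _ ≤ LogEulerProduct.tailConst d * ∑ p ∈ Nat.primesLE X, (1 : ℝ) / (p * (p - 1)) := by
          refine mul_le_mul_of_nonneg_left (sum_le_sum fun p hp => ?_) hS
          have hp2 : (2 : ℝ) ≤ p := by exact_mod_cast (Nat.mem_primesLE.1 hp).2.two_le
          exact one_div_le_one_div_of_le (by nlinarith) (by nlinarith)
      _ ≤ LogEulerProduct.tailConst d * 1 :=
          mul_le_mul_of_nonneg_left (MertensBound.sum_inv_prime_mul_pred_le_one X) hS
      _ = LogEulerProduct.tailConst d := mul_one _
  have hexp : ∑ p ∈ Nat.primesLE X, (f p / p + LogEulerProduct.tailConst d / (p : ℝ) ^ 2) ≤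
      ∑ p ∈ Nat.primesLE X, f p / p + LogEulerProduct.tailConst d := by
    rw [sum_add_distrib]; linarith
  calc ∑ n ∈ Icc 1 X, f n / n
      ≤ ∏ p ∈ Nat.primesLE X, ∑' ν : ℕ, f (p ^ ν) / (p : ℝ) ^ ν :=
        HallTenenbaum.sum_div_le_prod_tsum hf1 hmul hf0 hsum X
    _ ≤ Real.exp (∑ p ∈ Nat.primesLE X, (f p / p + LogEulerProduct.tailConst d / (p : ℝ) ^ 2)) := hprod
    _ ≤ _ := Real.exp_le_exp.2 hexp

/-- **The squared form with a prime majorant `w`.** Let `G ≥ 0` be multiplicative with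
`G(p^ν) ≤ (ν+1)^d` and `G(p)² ≤ w(p)` at primes. Then for every `X`,
`∑_{n≤X} G(n)²/n ≤ exp(∑_{p≤X} w(p)/p + S_{2d})`. [folklore] -/
theorem sum_sq_div_le_exp_sum {G : ℕ → ℝ} (hG1 : G 1 = 1)
    (hmul : ∀ m n, Nat.Coprime m n → G (m * n) = G m * G n) (hG0 : ∀ n, 0 ≤ G n) {d : ℕ}
    (hGpow : ∀ p ν : ℕ, p.Prime → G (p ^ ν) ≤ ((ν : ℝ) + 1) ^ d) {w : ℕ → ℝ}
    (hGp : ∀ p, p.Prime → G p ^ 2 ≤ w p) (X : ℕ) :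
    ∑ n ∈ Icc 1 X, G n ^ 2 / n ≤
      Real.exp (∑ p ∈ Nat.primesLE X, w p / p + LogEulerProduct.tailConst (2 * d)) := by
  have h := sum_div_le_exp_sum (f := fun n => G n ^ 2) (d := 2 * d)
    (by simp [hG1]) (fun m n hmn => by simp only [hmul m n hmn]; ring) (fun n => sq_nonneg _)
    (fun p ν hp => by
      calc G (p ^ ν) ^ 2 ≤ (((ν : ℝ) + 1) ^ d) ^ 2 := pow_le_pow_left₀ (hG0 _) (hGpow p ν hp) 2
        _ = ((ν : ℝ) + 1) ^ (2 * d) := by rw [← pow_mul, mul_comm]) X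
  refine h.trans (Real.exp_le_exp.2 ?_)
  have : ∑ p ∈ Nat.primesLE X, G p ^ 2 / (p : ℝ) ≤ ∑ p ∈ Nat.primesLE X, w p / p :=
    sum_le_sum fun p hp =>
      div_le_div_of_nonneg_right (hGp p (Nat.mem_primesLE.1 hp).2) (Nat.cast_nonneg _)
  linarith

/-- Domination transfers the mean square: `|u(n)| ≤ C·G(n)` (`n ≥ 1`) gives
`∑_{n≤X} |u(n)|²/n ≤ C² ∑_{n≤X} G(n)²/n`. [folklore] -/
theorem sum_norm_sq_div_le_of_le {u : ℕ → ℂ} {C : ℝ} {G : ℕ → ℝ}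
    (hu : ∀ n, n ≠ 0 → ‖u n‖ ≤ C * G n) (X : ℕ) :
    ∑ n ∈ Icc 1 X, ‖u n‖ ^ 2 / n ≤ C ^ 2 * ∑ n ∈ Icc 1 X, G n ^ 2 / n := by
  rw [mul_sum]
  refine sum_le_sum fun n hn => ?_
  have hn0 : n ≠ 0 := by have := (mem_Icc.1 hn).1; omega
  rw [← mul_div_assoc, ← mul_pow]
  exact div_le_div_of_nonneg_right (pow_le_pow_left₀ (norm_nonneg _) (hu n hn0) 2)
    (Nat.cast_nonneg _)

/-- `t² ≤ m² + (2m + M)u` whenever `0 ≤ t ≤ m + M`, `t ≤ m + u` (`m, M, u ≥ 0`): the square of a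
majorant `m + min(M, u)` costs `m²` plus a term LINEAR in `u` (`u ≥ M`: `t² ≤ (m+M)² ≤ m² + (2m+M)u`;
`u < M`: `t² ≤ (m+u)² ≤ m² + (2m+M)u`). With `u = B log p`, `B = O(1/log P)`, the linear term is
what makes the shift cancellation `|p^{-iβ} − 1| ≤ |β| log p` cost only a constant factor
`exp(O(B log X))` in the Euler product (cf. `sq_le_nine_add`, the case `m = 3`, `M = 2`). [folklore] -/
theorem sq_le_add {t m M u : ℝ} (ht0 : 0 ≤ t) (hm : 0 ≤ m) (hM : 0 ≤ M) (hu : 0 ≤ u)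
    (htM : t ≤ m + M) (htu : t ≤ m + u) : t ^ 2 ≤ m ^ 2 + (2 * m + M) * u := by
  rcases le_or_gt M u with h | h
  · nlinarith [mul_nonneg ht0 (sub_nonneg.2 htM), mul_nonneg (add_nonneg hm hM) (sub_nonneg.2 htM)]
  · nlinarith [mul_nonneg ht0 (sub_nonneg.2 htu), mul_nonneg (add_nonneg hm hu) (sub_nonneg.2 htu),
      mul_nonneg hu (sub_nonneg.2 h.le)]

/-- **One-scale squared form** (generalises `sum_sq_div_le`: there `m = 3`, `M = 2`). Let `g ≥ 0` be
multiplicative with `g(p) ≤ m + B log p`, `g(p) ≤ m + M` (`B ≥ 0`, `m M : ℕ`) and `g(p^ν) ≤ (ν+1)^d`.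
Then for `X ≥ 2`, `∑_{n≤X} g(n)²/n ≤ majorantConst (m²) (2d) · exp((2m+M)B · log 4X) · (log X)^{m²}`.
[folklore] -/
theorem sum_sq_div_le_gen {g : ℕ → ℝ} (hg1 : g 1 = 1)
    (hmul : ∀ m n, Nat.Coprime m n → g (m * n) = g m * g n) (hg0 : ∀ n, 0 ≤ g n)
    {B : ℝ} (hB : 0 ≤ B) {d m M : ℕ}
    (hgp : ∀ p, p.Prime → g p ≤ m + B * Real.log p) (hgpM : ∀ p, p.Prime → g p ≤ m + M)
    (hgpow : ∀ p ν : ℕ, p.Prime → g (p ^ ν) ≤ ((ν : ℝ) + 1) ^ d) {X : ℕ} (hX : 2 ≤ X) :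
    ∑ n ∈ Icc 1 X, g n ^ 2 / n ≤
      majorantConst (m ^ 2) (2 * d) * Real.exp ((2 * m + M) * B * Real.log (4 * X)) *
        Real.log X ^ (m ^ 2) := by
  have h := sum_div_le (f := fun n => g n ^ 2) (a := m ^ 2) (d := 2 * d) (K := (2 * m + M) * B)
    (by simp [hg1]) (fun m n hmn => by simp only [hmul m n hmn]; ring) (fun n => sq_nonneg _)
    (by positivity) ?_ ?_ hX
  · exact h
  · intro p hp
    have hlogp : 0 ≤ Real.log p := Real.log_nonneg (by exact_mod_cast hp.one_lt.le)
    have := sq_le_add (hg0 p) (Nat.cast_nonneg m) (Nat.cast_nonneg M) (mul_nonneg hB hlogp)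
      (hgpM p hp) (hgp p hp)
    push_cast
    linarith
  · intro p ν hp
    calc g (p ^ ν) ^ 2 ≤ (((ν : ℝ) + 1) ^ d) ^ 2 := pow_le_pow_left₀ (hg0 _) (hgpow p ν hp) 2
      _ = ((ν : ℝ) + 1) ^ (2 * d) := by rw [← pow_mul, mul_comm]

/-! ### Part 2. Cutoffs, the split-prime sum, and the evaluation of the piecewise prime sum -/

/-- `cutInd y p = [p ≤ y]` (as a real number). [folklore] -/
def cutInd (y p : ℕ) : ℝ := if p ≤ y then 1 else 0

/-- `cutInd y p = 1` for `p ≤ y`. [folklore] -/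
theorem cutInd_of_le {y p : ℕ} (h : p ≤ y) : cutInd y p = 1 := if_pos h

/-- `cutInd y p = 0` for `p > y`. [folklore] -/
theorem cutInd_of_lt {y p : ℕ} (h : y < p) : cutInd y p = 0 := if_neg (not_le.2 h)

/-- `cutInd y p ∈ {0, 1}`. [folklore] -/
theorem cutInd_zero_or_one (y p : ℕ) : cutInd y p = 0 ∨ cutInd y p = 1 := by
  unfold cutInd; split_ifs <;> simp

/-- `0 ≤ cutInd y p`. [folklore] -/
theorem cutInd_nonneg (y p : ℕ) : 0 ≤ cutInd y p := by
  rcases cutInd_zero_or_one y p with h | h <;> rw [h]; exact zero_le_one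

/-- `cutInd y p ≤ 1`. [folklore] -/
theorem cutInd_le_one (y p : ℕ) : cutInd y p ≤ 1 := by
  rcases cutInd_zero_or_one y p with h | h <;> rw [h]; exact zero_le_one

/-- Nesting: `y ≤ y'` gives `[p ≤ y] ≤ [p ≤ y']`. [folklore] -/
theorem cutInd_mono {y y' : ℕ} (h : y ≤ y') (p : ℕ) : cutInd y p ≤ cutInd y' p := by
  unfold cutInd
  split_ifs with h1 h2
  · exact le_rfl
  · exact absurd (h1.trans h) h2
  · exact zero_le_one
  · exact le_rfl

/-- **The split-prime sum** `S(s; y₀, X) = ∑_{p ≤ X, p ≤ y₀} s(p)/p` of a density `s` (in the source's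
setting `s(p) = (1 + χ(p))/2 = ν(p)/2`, the indicator of the primes split in the quadratic field of
`χ`, and `y₀ = D⁴`): kept SYMBOLIC — its size under the hypothesis (A) is the manuscript's business
(Lemmas 3.x, 4.x), the cell's parameter `sSplit` being its scale in units of `log 𝓛`. Trivially
`0 ≤ S ≤ log log y₀ + 4` for `0 ≤ s ≤ 1` (`splitSum_le`). [cite: Zhang2022LandauSiegel, §3 p. 7 (ν = 1 ∗ χ)] -/
def splitSum (s : ℕ → ℝ) (y₀ X : ℕ) : ℝ := ∑ p ∈ Nat.primesLE X, cutInd y₀ p * s p / p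

/-- `∑_{p ≤ X} [p ≤ y]/p ≤ log log y + 4` (`y ≥ 2`; the tree's Mertens bound at `y`). [folklore] -/
theorem sum_cutInd_div_prime_le {y : ℕ} (hy : 2 ≤ y) (X : ℕ) :
    ∑ p ∈ Nat.primesLE X, cutInd y p / p ≤ Real.log (Real.log y) + 4 := by
  have h1 : ∑ p ∈ Nat.primesLE X, cutInd y p / p =
      ∑ p ∈ (Nat.primesLE X).filter (· ≤ y), (1 : ℝ) / p := by
    rw [sum_filter]
    exact sum_congr rfl fun p _ => by unfold cutInd; split_ifs <;> simp
  rw [h1]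
  calc ∑ p ∈ (Nat.primesLE X).filter (· ≤ y), (1 : ℝ) / p
      ≤ ∑ p ∈ Nat.primesLE y, (1 : ℝ) / p := by
        apply sum_le_sum_of_subset_of_nonneg
        · intro p hp
          rw [mem_filter, Nat.mem_primesLE] at hp
          exact Nat.mem_primesLE.2 ⟨hp.2, hp.1.2⟩
        · intro p _ _; positivity
    _ ≤ _ := MertensBound.sum_inv_prime_le y hy

/-- `0 ≤ S(s; y₀, X)` for `s ≥ 0`. [folklore] -/
theorem splitSum_nonneg {s : ℕ → ℝ} (hs : ∀ p, 0 ≤ s p) (y₀ X : ℕ) : 0 ≤ splitSum s y₀ X :=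
  sum_nonneg fun p _ => div_nonneg (mul_nonneg (cutInd_nonneg _ _) (hs p)) (Nat.cast_nonneg _)

/-- `S(s; y₀, X) ≤ log log y₀ + 4` for `s ≤ 1`, `y₀ ≥ 2` (the full Mertens scale; the point of
keeping `S` symbolic is that it may be much smaller). [folklore] -/
theorem splitSum_le {s : ℕ → ℝ} (hs1 : ∀ p, s p ≤ 1) {y₀ : ℕ} (hy₀ : 2 ≤ y₀)
    (X : ℕ) : splitSum s y₀ X ≤ Real.log (Real.log y₀) + 4 := by
  refine le_trans (sum_le_sum fun p _ => ?_) (sum_cutInd_div_prime_le hy₀ X)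
  exact div_le_div_of_nonneg_right
    (mul_le_of_le_one_right (cutInd_nonneg _ _) (hs1 p)) (Nat.cast_nonneg _)

/-- **The piecewise prime sum.** For `e₀, e₁, e₂, K ≥ 0`, any `c`, and `y₁, y₂, X ≥ 2`:
`∑_{p≤X} (e₀ + e₁[p≤y₁] + e₂[p≤y₂] + c[p≤y₀]s(p) + K log p)/p`
`≤ e₀(log log X + 4) + e₁(log log y₁ + 4) + e₂(log log y₂ + 4) + c·S(s; y₀, X) + K(log X + log 4)`
(Mertens twice, at `X` and at the cutoffs). [folklore] -/
theorem sum_pw_div_prime_le {e₀ e₁ e₂ K : ℝ} (he₀ : 0 ≤ e₀) (he₁ : 0 ≤ e₁) (he₂ : 0 ≤ e₂)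
    (hK : 0 ≤ K) (c : ℝ) (s : ℕ → ℝ) (y₀ : ℕ) {y₁ y₂ X : ℕ} (hy₁ : 2 ≤ y₁) (hy₂ : 2 ≤ y₂)
    (hX : 2 ≤ X) :
    ∑ p ∈ Nat.primesLE X,
        (e₀ + e₁ * cutInd y₁ p + e₂ * cutInd y₂ p + c * (cutInd y₀ p * s p) + K * Real.log p) / p ≤
      e₀ * (Real.log (Real.log X) + 4) + e₁ * (Real.log (Real.log y₁) + 4) +
        e₂ * (Real.log (Real.log y₂) + 4) + c * splitSum s y₀ X +
        K * (Real.log X + Real.log 4) := by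
  have eq : ∑ p ∈ Nat.primesLE X,
        (e₀ + e₁ * cutInd y₁ p + e₂ * cutInd y₂ p + c * (cutInd y₀ p * s p) + K * Real.log p) / p =
      e₀ * ∑ p ∈ Nat.primesLE X, (1 : ℝ) / p + e₁ * ∑ p ∈ Nat.primesLE X, cutInd y₁ p / p +
        e₂ * ∑ p ∈ Nat.primesLE X, cutInd y₂ p / p + c * splitSum s y₀ X +
        K * ∑ p ∈ Nat.primesLE X, Real.log p / p := by
    simp only [splitSum, mul_sum, ← sum_add_distrib]
    exact sum_congr rfl fun p _ => by ring
  rw [eq]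
  have h0 := MertensBound.sum_inv_prime_le X hX
  have h1 := sum_cutInd_div_prime_le hy₁ X
  have h2 := sum_cutInd_div_prime_le hy₂ X
  have h3 := MertensBound.sum_log_div_prime_le X
  gcongr

/-- **The evaluated bound** of the cell's counts:
`scaleBound e₀ e₁ e₂ c d K s y₀ y₁ y₂ X = majorantConst (e₀+e₁+e₂) d · exp(K log 4X) · exp(c·S(s;y₀,X))`
`· (log X)^{e₀} (log y₁)^{e₁} (log y₂)^{e₂}` — exponent `e₀` on the full scale `log X`, `e₁`, `e₂` on the
scales of the supports `y₁`, `y₂` of the short factors, `c` in front of the split-prime sum, and the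
shift-cancellation factor `exp(K log 4X)` (`= O(1)` when `K = O(1/log X)`). [folklore] -/
def scaleBound (e₀ e₁ e₂ c d : ℕ) (K : ℝ) (s : ℕ → ℝ) (y₀ y₁ y₂ X : ℕ) : ℝ :=
  majorantConst (e₀ + e₁ + e₂) d * Real.exp (K * Real.log (4 * X)) *
    Real.exp (c * splitSum s y₀ X) * (Real.log X ^ e₀ * Real.log y₁ ^ e₁ * Real.log y₂ ^ e₂)

/-- `0 < scaleBound …` (`y₁, y₂, X ≥ 2`). [folklore] -/
theorem scaleBound_pos (e₀ e₁ e₂ c d : ℕ) (K : ℝ) (s : ℕ → ℝ) (y₀ : ℕ) {y₁ y₂ X : ℕ}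
    (hy₁ : 2 ≤ y₁) (hy₂ : 2 ≤ y₂) (hX : 2 ≤ X) : 0 < scaleBound e₀ e₁ e₂ c d K s y₀ y₁ y₂ X := by
  have hlX : 0 < Real.log X := Real.log_pos (by exact_mod_cast hX)
  have hl1 : 0 < Real.log y₁ := Real.log_pos (by exact_mod_cast hy₁)
  have hl2 : 0 < Real.log y₂ := Real.log_pos (by exact_mod_cast hy₂)
  unfold scaleBound
  have := majorantConst_pos (e₀ + e₁ + e₂) d
  positivity

/-- The exponential of the evaluated prime sum IS `scaleBound` (`exp(e log log y) = (log y)^e`,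
`log 4X = log X + log 4`). [folklore] -/
theorem exp_pw_eq_scaleBound (e₀ e₁ e₂ c d : ℕ) (K : ℝ) (s : ℕ → ℝ) (y₀ : ℕ) {y₁ y₂ X : ℕ}
    (hy₁ : 2 ≤ y₁) (hy₂ : 2 ≤ y₂) (hX : 2 ≤ X) :
    Real.exp ((e₀ : ℝ) * (Real.log (Real.log X) + 4) + e₁ * (Real.log (Real.log y₁) + 4) +
        e₂ * (Real.log (Real.log y₂) + 4) + c * splitSum s y₀ X + K * (Real.log X + Real.log 4) +
        LogEulerProduct.tailConst d) = scaleBound e₀ e₁ e₂ c d K s y₀ y₁ y₂ X := by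
  have hX2 : (2 : ℝ) ≤ X := by exact_mod_cast hX
  have hX0 : (0 : ℝ) < X := by linarith
  have hlX : 0 < Real.log X := Real.log_pos (by exact_mod_cast hX)
  have hl1 : 0 < Real.log y₁ := Real.log_pos (by exact_mod_cast hy₁)
  have hl2 : 0 < Real.log y₂ := Real.log_pos (by exact_mod_cast hy₂)
  have e4 : Real.log (4 * X) = Real.log X + Real.log 4 := by
    rw [Real.log_mul (by norm_num) hX0.ne', add_comm]
  have p0 : Real.log X ^ e₀ = Real.exp (e₀ * Real.log (Real.log X)) := by
    rw [← Real.log_pow, Real.exp_log (pow_pos hlX _)]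
  have p1 : Real.log y₁ ^ e₁ = Real.exp (e₁ * Real.log (Real.log y₁)) := by
    rw [← Real.log_pow, Real.exp_log (pow_pos hl1 _)]
  have p2 : Real.log y₂ ^ e₂ = Real.exp (e₂ * Real.log (Real.log y₂)) := by
    rw [← Real.log_pow, Real.exp_log (pow_pos hl2 _)]
  rw [scaleBound, majorantConst, e4, p0, p1, p2]
  simp only [← Real.exp_add]
  congr 1
  push_cast
  ring

/-- **The engine of this file.** Let `G ≥ 0` be multiplicative with `G(p^ν) ≤ (ν+1)^d` and, at primes,
`G(p)² ≤ e₀ + e₁[p≤y₁] + e₂[p≤y₂] + c[p≤y₀]s(p) + K log p` (`K ≥ 0`; `y₁, y₂ ≥ 2`). Then for `X ≥ 2`,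
`∑_{n≤X} G(n)²/n ≤ scaleBound e₀ e₁ e₂ c (2d) K s y₀ y₁ y₂ X`. [folklore] -/
theorem sum_sq_div_le_scaleBound {G : ℕ → ℝ} (hG1 : G 1 = 1)
    (hmul : ∀ m n, Nat.Coprime m n → G (m * n) = G m * G n) (hG0 : ∀ n, 0 ≤ G n) {d : ℕ}
    (hGpow : ∀ p ν : ℕ, p.Prime → G (p ^ ν) ≤ ((ν : ℝ) + 1) ^ d)
    {e₀ e₁ e₂ c : ℕ} {K : ℝ} (hK : 0 ≤ K) {s : ℕ → ℝ} {y₀ y₁ y₂ : ℕ} (hy₁ : 2 ≤ y₁)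
    (hy₂ : 2 ≤ y₂)
    (hGp : ∀ p, p.Prime → G p ^ 2 ≤
      (e₀ : ℝ) + e₁ * cutInd y₁ p + e₂ * cutInd y₂ p + c * (cutInd y₀ p * s p) + K * Real.log p)
    {X : ℕ} (hX : 2 ≤ X) :
    ∑ n ∈ Icc 1 X, G n ^ 2 / n ≤ scaleBound e₀ e₁ e₂ c (2 * d) K s y₀ y₁ y₂ X := by
  refine (sum_sq_div_le_exp_sum hG1 hmul hG0 hGpow hGp X).trans ?_
  rw [← exp_pw_eq_scaleBound e₀ e₁ e₂ c (2 * d) K s y₀ hy₁ hy₂ hX]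
  refine Real.exp_le_exp.2 ?_
  have := sum_pw_div_prime_le (Nat.cast_nonneg e₀) (Nat.cast_nonneg e₁) (Nat.cast_nonneg e₂)
    hK (c : ℝ) s y₀ hy₁ hy₂ hX
  linarith


/-! ### Part 3. Majorant blocks, domination, and their algebra -/

/-- A MAJORANT BLOCK of degree `c`: a multiplicative `g ≥ 0` with `g(p^i) ≤ (i+1)^c` at prime powers
(so `g 1 = 1`). The blocks of this file: `|κ₂|` (`c = 1`), `|κ₁|` (`c = 2`), `τ_j` (`c = j`), the
`y`-smooth indicator (`c = 0`), a `ν`-type function (`c = 1`), pointwise products of a block with a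
smooth indicator (same `c`); Dirichlet products of blocks are blocks (`IsBlock.mul`). [folklore] -/
structure IsBlock (g : ArithmeticFunction ℝ) (c : ℕ) : Prop where
  isMult : g.IsMultiplicative
  nonneg : ∀ n, 0 ≤ g n
  pow_le : ∀ p i : ℕ, p.Prime → g (p ^ i) ≤ ((i : ℝ) + 1) ^ c

/-- Dirichlet products of blocks are blocks, of degree `c₁ + c₂ + 1` (nonnegativity of `g₁ ∗ g₂` as
in `BombieriSieve.mul_apply_nonneg`; prime powers by `mul_apply_prime_pow_le_of_nonneg`). [folklore] -/
theorem IsBlock.mul {g₁ g₂ : ArithmeticFunction ℝ} {c₁ c₂ : ℕ} (h₁ : IsBlock g₁ c₁)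
    (h₂ : IsBlock g₂ c₂) : IsBlock (g₁ * g₂) (c₁ + c₂ + 1) :=
  ⟨h₁.isMult.mul h₂.isMult,
    fun n => by rw [mul_apply]; exact sum_nonneg fun x _ => mul_nonneg (h₁.nonneg _) (h₂.nonneg _),
    fun p i hp => mul_apply_prime_pow_le_of_nonneg hp (fun j => h₁.pow_le p j hp)
      (fun j => h₂.pow_le p j hp) (fun _ => h₂.nonneg _) i⟩

/-- At a prime the values of blocks ADD under Dirichlet product. [folklore] -/
theorem IsBlock.mul_prime {g₁ g₂ : ArithmeticFunction ℝ} {c₁ c₂ : ℕ} (h₁ : IsBlock g₁ c₁)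
    (h₂ : IsBlock g₂ c₂) {p : ℕ} (hp : p.Prime) : (g₁ * g₂) p = g₁ p + g₂ p :=
  mul_apply_prime h₁.isMult.map_one h₂.isMult.map_one hp

/-- **The engine on a block.** [folklore] -/
theorem IsBlock.sum_sq_div_le {G : ArithmeticFunction ℝ} {d : ℕ} (hG : IsBlock G d)
    {e₀ e₁ e₂ c : ℕ} {K : ℝ} (hK : 0 ≤ K) {s : ℕ → ℝ} {y₀ y₁ y₂ : ℕ} (hy₁ : 2 ≤ y₁)
    (hy₂ : 2 ≤ y₂)
    (hGp : ∀ p, p.Prime → G p ^ 2 ≤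
      (e₀ : ℝ) + e₁ * cutInd y₁ p + e₂ * cutInd y₂ p + c * (cutInd y₀ p * s p) + K * Real.log p)
    {X : ℕ} (hX : 2 ≤ X) :
    ∑ n ∈ Icc 1 X, G n ^ 2 / n ≤ scaleBound e₀ e₁ e₂ c (2 * d) K s y₀ y₁ y₂ X :=
  sum_sq_div_le_scaleBound hG.isMult.map_one (fun _ _ h => hG.isMult.map_mul_of_coprime h)
    hG.nonneg hG.pow_le hK hy₁ hy₂ hGp hX

/-- DOMINATION: `u ≪ C·g` on `n ≥ 1`, i.e. `‖u n‖ ≤ C g(n)` for all `n ≠ 0`. [folklore] -/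
def Dom (u : ℕ → ℂ) (C : ℝ) (g : ArithmeticFunction ℝ) : Prop := ∀ n, n ≠ 0 → ‖u n‖ ≤ C * g n

/-- **Majorants multiply under convolution**: `u ≪ C₁ g₁`, `v ≪ C₂ g₂` give `u ⋆ v ≪ C₁C₂ (g₁ ∗ g₂)`
(no sign hypotheses: `0 ≤ ‖u‖ ≤ C₁ g₁` is used). Generalises `norm_seqConv_le_tau`. [folklore] -/
theorem dom_seqConv {u v : ℕ → ℂ} {C₁ C₂ : ℝ} {g₁ g₂ : ArithmeticFunction ℝ}
    (hu : Dom u C₁ g₁) (hv : Dom v C₂ g₂) : Dom (seqConv u v) (C₁ * C₂) (g₁ * g₂) := by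
  intro n _
  rw [mul_apply, mul_sum]
  calc ‖seqConv u v n‖ ≤ ∑ x ∈ n.divisorsAntidiagonal, ‖u x.1 * v x.2‖ := norm_sum_le _ _
    _ ≤ ∑ x ∈ n.divisorsAntidiagonal, C₁ * C₂ * (g₁ x.1 * g₂ x.2) :=
        sum_le_sum fun x hx => by
          have hx' := Nat.mem_divisorsAntidiagonal.1 hx
          have h1 : x.1 ≠ 0 := by intro h; apply hx'.2; rw [← hx'.1, h, zero_mul]
          have h2 : x.2 ≠ 0 := by intro h; apply hx'.2; rw [← hx'.1, h, mul_zero]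
          rw [norm_mul]
          calc ‖u x.1‖ * ‖v x.2‖ ≤ (C₁ * g₁ x.1) * (C₂ * g₂ x.2) :=
                mul_le_mul (hu _ h1) (hv _ h2) (norm_nonneg _) ((norm_nonneg _).trans (hu _ h1))
            _ = C₁ * C₂ * (g₁ x.1 * g₂ x.2) := by ring

/-- A sequence pointwise smaller in norm inherits the domination (e.g. complex conjugates,
unimodular twists `n^{-iβ} u(n)`, `ψ(n) u(n)`). [folklore] -/
theorem dom_of_norm_le {u v : ℕ → ℂ} {C : ℝ} {g : ArithmeticFunction ℝ} (h : Dom u C g)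
    (huv : ∀ n, ‖v n‖ ≤ ‖u n‖) : Dom v C g := fun n hn => (huv n).trans (h n hn)

/-- `κ ≪ 1 · |κ|`. [folklore] -/
theorem dom_normAF (κ : ArithmeticFunction ℂ) : Dom (fun n => κ n) 1 (normAF κ) :=
  fun n _ => by rw [normAF_apply, one_mul]

/-- A bounded sequence: `u ≪ C · τ₁` (`τ₁ = ζ ≡ 1` on `n ≥ 1`). [folklore] -/
theorem dom_tau_one {u : ℕ → ℂ} {C : ℝ} (hu : ∀ n, n ≠ 0 → ‖u n‖ ≤ C) : Dom u C (tau 1) :=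
  fun n hn => by rw [tau_one_apply hn, mul_one]; exact hu n hn

/-- **Domination + block ⇒ mean square.** `u ≪ C·G`, `G` a block of degree `d` with the piecewise
prime bound ⇒ `∑_{n≤X} |u(n)|²/n ≤ C² · scaleBound e₀ e₁ e₂ c (2d) K s y₀ y₁ y₂ X`. [folklore] -/
theorem sum_norm_sq_div_le_of_dom {u : ℕ → ℂ} {C : ℝ} {G : ArithmeticFunction ℝ} {d : ℕ}
    (hu : Dom u C G) (hG : IsBlock G d)
    {e₀ e₁ e₂ c : ℕ} {K : ℝ} (hK : 0 ≤ K) {s : ℕ → ℝ} {y₀ y₁ y₂ : ℕ} (hy₁ : 2 ≤ y₁)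
    (hy₂ : 2 ≤ y₂)
    (hGp : ∀ p, p.Prime → G p ^ 2 ≤
      (e₀ : ℝ) + e₁ * cutInd y₁ p + e₂ * cutInd y₂ p + c * (cutInd y₀ p * s p) + K * Real.log p)
    {X : ℕ} (hX : 2 ≤ X) :
    ∑ n ∈ Icc 1 X, ‖u n‖ ^ 2 / n ≤ C ^ 2 * scaleBound e₀ e₁ e₂ c (2 * d) K s y₀ y₁ y₂ X :=
  (sum_norm_sq_div_le_of_le hu X).trans
    (mul_le_mul_of_nonneg_left (hG.sum_sq_div_le hK hy₁ hy₂ hGp hX) (sq_nonneg _))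

/-! #### The divisor-function and `κ` blocks -/

/-- `τ_j` is a block of degree `j`. [folklore] -/
theorem isBlock_tau (j : ℕ) : IsBlock (tau j) j :=
  ⟨isMultiplicative_tau j, tau_nonneg j, fun _ i hp => tau_prime_pow_le j hp i⟩

/-- `|κ₂|` is a block of degree `1`. [folklore] -/
theorem isBlock_normAF_kappa₂ (b₁ : ℝ) : IsBlock (normAF (kappa₂ b₁)) 1 :=
  ⟨isMultiplicative_normAF (isMultiplicative_kappa₂ b₁),
    fun n => by rw [normAF_apply]; exact norm_nonneg _,
    fun p i hp => by rw [normAF_apply]; exact norm_kappa₂_prime_pow_le b₁ hp i⟩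

/-- `|κ₁|` is a block of degree `2`. [folklore] -/
theorem isBlock_normAF_kappa₁ (b₁ b₂ : ℝ) : IsBlock (normAF (kappa₁ b₁ b₂)) 2 :=
  ⟨isMultiplicative_normAF (isMultiplicative_kappa₁ b₁ b₂),
    fun n => by rw [normAF_apply]; exact norm_nonneg _,
    fun p i hp => by rw [normAF_apply]; exact norm_kappa₁_prime_pow_le b₁ b₂ hp i⟩

/-! #### The smooth indicator: how SUPPORT enters the Euler product -/

/-- The `y`-SMOOTH INDICATOR: `smoothIndLE y n = 1` if every prime factor of `n ≥ 1` is `≤ y`, else `0`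
(`smoothIndLE y 0 = 0`). Multiplicative, `= [p ≤ y]` at prime powers, and `= 1` on `1 ≤ n ≤ y`: the
multiplicative majorant of the indicator of `n ≤ y`, through which the SUPPORT of a short Dirichlet
polynomial enters the Euler product — a factor supported on `n ≤ y` contributes `[p ≤ y]`, not `1`,
at the prime `p`, hence `log log y` and not `log log X` to the prime sum. (Not the tree's
`GreenTao2008.smoothInd q` = indicator of `primeFactors n ⊆ primeFactors q`; here smoothness is by
SIZE, `p ≤ y`, whence the suffix `LE`.) [folklore] -/
def smoothIndLE (y : ℕ) : ArithmeticFunction ℝ :=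
  ⟨fun n => if n = 0 then 0 else if ∀ p ∈ n.primeFactors, p ≤ y then 1 else 0, if_pos rfl⟩

/-- Unfolding `smoothIndLE`. [folklore] -/
theorem smoothIndLE_apply' (y n : ℕ) :
    smoothIndLE y n = if n = 0 then 0 else if ∀ p ∈ n.primeFactors, p ≤ y then 1 else 0 := rfl

/-- Unfolding `smoothIndLE` at `n ≠ 0`. [folklore] -/
theorem smoothIndLE_apply {y n : ℕ} (hn : n ≠ 0) :
    smoothIndLE y n = if ∀ p ∈ n.primeFactors, p ≤ y then 1 else 0 := by
  rw [smoothIndLE_apply', if_neg hn]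

/-- `smoothIndLE y n ∈ {0, 1}`. [folklore] -/
theorem smoothIndLE_zero_or_one (y n : ℕ) : smoothIndLE y n = 0 ∨ smoothIndLE y n = 1 := by
  rw [smoothIndLE_apply']; split_ifs <;> simp

/-- `0 ≤ smoothIndLE y n`. [folklore] -/
theorem smoothIndLE_nonneg (y n : ℕ) : 0 ≤ smoothIndLE y n := by
  rcases smoothIndLE_zero_or_one y n with h | h <;> rw [h]; exact zero_le_one

/-- `smoothIndLE y n ≤ 1`. [folklore] -/
theorem smoothIndLE_le_one (y n : ℕ) : smoothIndLE y n ≤ 1 := by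
  rcases smoothIndLE_zero_or_one y n with h | h <;> rw [h]; exact zero_le_one

/-- `smoothIndLE y n = 1` for `1 ≤ n ≤ y` (every prime factor of `n` is `≤ n ≤ y`). [folklore] -/
theorem smoothIndLE_eq_one_of_le {y n : ℕ} (hn : n ≠ 0) (hny : n ≤ y) : smoothIndLE y n = 1 := by
  rw [smoothIndLE_apply hn, if_pos]
  exact fun p hp => (Nat.le_of_mem_primeFactors hp).trans hny

/-- `smoothIndLE y` is multiplicative. [folklore] -/
theorem isMultiplicative_smoothIndLE (y : ℕ) : (smoothIndLE y).IsMultiplicative := by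
  rw [IsMultiplicative.iff_ne_zero]
  refine ⟨by simp [smoothIndLE_apply'], fun {m n} hm hn _ => ?_⟩
  rw [smoothIndLE_apply (mul_ne_zero hm hn), smoothIndLE_apply hm, smoothIndLE_apply hn,
    Nat.primeFactors_mul hm hn]
  by_cases h1 : ∀ p ∈ m.primeFactors, p ≤ y
  · by_cases h2 : ∀ p ∈ n.primeFactors, p ≤ y
    · rw [if_pos h1, if_pos h2, one_mul,
        if_pos fun p hp => (Finset.mem_union.1 hp).elim (h1 p) (h2 p)]
    · rw [if_pos h1, if_neg h2, one_mul,
        if_neg fun h => h2 fun p hp => h p (Finset.mem_union_right _ hp)]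
  · rw [if_neg h1, zero_mul, if_neg fun h => h1 fun p hp => h p (Finset.mem_union_left _ hp)]

/-- At a prime power `p^k`, `k ≥ 1`: `smoothIndLE y (p^k) = [p ≤ y]`. [folklore] -/
theorem smoothIndLE_prime_pow {y p : ℕ} (hp : p.Prime) {k : ℕ} (hk : k ≠ 0) :
    smoothIndLE y (p ^ k) = cutInd y p := by
  rw [smoothIndLE_apply (pow_ne_zero k hp.ne_zero), Nat.primeFactors_prime_pow hk hp]
  simp only [Finset.mem_singleton, forall_eq]
  rfl

/-- At a prime: `smoothIndLE y p = [p ≤ y]`. [folklore] -/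
theorem smoothIndLE_prime {y p : ℕ} (hp : p.Prime) : smoothIndLE y p = cutInd y p := by
  have h := smoothIndLE_prime_pow (y := y) hp one_ne_zero
  rwa [pow_one] at h

/-- `smoothIndLE y` is a block of degree `0`. [folklore] -/
theorem isBlock_smoothIndLE (y : ℕ) : IsBlock (smoothIndLE y) 0 :=
  ⟨isMultiplicative_smoothIndLE y, smoothIndLE_nonneg y, fun p i _ => by
    rw [pow_zero]; exact smoothIndLE_le_one y _⟩

/-- The pointwise product of a block with a smooth indicator is a block of the same degree.
[folklore] -/
theorem IsBlock.pmul_smoothIndLE {g : ArithmeticFunction ℝ} {c : ℕ} (hg : IsBlock g c) (y : ℕ) :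
    IsBlock (g.pmul (smoothIndLE y)) c :=
  ⟨hg.isMult.pmul (isMultiplicative_smoothIndLE y),
    fun n => by rw [pmul_apply]; exact mul_nonneg (hg.nonneg n) (smoothIndLE_nonneg y n),
    fun p i hp => by
      rw [pmul_apply]
      exact (mul_le_of_le_one_right (hg.nonneg _) (smoothIndLE_le_one y _)).trans (hg.pow_le p i hp)⟩

/-- Prime value of `g · [y-smooth]`: `g(p)·[p ≤ y]`. [folklore] -/
theorem pmul_smoothIndLE_prime (g : ArithmeticFunction ℝ) {y p : ℕ} (hp : p.Prime) :
    (g.pmul (smoothIndLE y)) p = g p * cutInd y p := by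
  rw [pmul_apply, smoothIndLE_prime hp]

/-- **SUPPORT ⇒ DOMINATION.** A sequence bounded by `C ≥ 0` on `n ≥ 1` and vanishing for `n > y`
satisfies `u ≪ C · smoothIndLE y`. [folklore] -/
theorem dom_smoothIndLE_of_support {u : ℕ → ℂ} {C : ℝ} {y : ℕ} (hC : 0 ≤ C)
    (hu : ∀ n, n ≠ 0 → ‖u n‖ ≤ C) (hsupp : ∀ n, y < n → u n = 0) : Dom u C (smoothIndLE y) := by
  intro n hn
  rcases le_or_gt n y with hny | hny
  · rw [smoothIndLE_eq_one_of_le hn hny, mul_one]; exact hu n hn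
  · rw [hsupp n hny, norm_zero]; exact mul_nonneg hC (smoothIndLE_nonneg y n)

/-- … and `u ≪ C·g` vanishing for `n > y` satisfies `u ≪ C · (g·smoothIndLE y)` (`C, g ≥ 0`).
[folklore] -/
theorem dom_pmul_smoothIndLE_of_support {u : ℕ → ℂ} {C : ℝ} {g : ArithmeticFunction ℝ} {y : ℕ}
    (hC : 0 ≤ C) (hg : ∀ n, 0 ≤ g n) (hu : Dom u C g) (hsupp : ∀ n, y < n → u n = 0) :
    Dom u C (g.pmul (smoothIndLE y)) := by
  intro n hn
  rw [pmul_apply]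
  rcases le_or_gt n y with hny | hny
  · rw [smoothIndLE_eq_one_of_le hn hny, mul_one]; exact hu n hn
  · rw [hsupp n hny, norm_zero]; exact mul_nonneg hC (mul_nonneg (hg n) (smoothIndLE_nonneg y n))

/-! #### `ν`-type blocks: the interface, and its construction from a real character -/

/-- The INTERFACE of a `ν`-TYPE majorant with split density `s`: `ν ≥ 0` multiplicative,
`ν(p) ≤ 2 s(p)` with `0 ≤ s ≤ 1`, `ν(p^i) ≤ i + 1`. Constructed below (`isNuType_nuChi`) for
`ν = 1 ∗ χ`, `χ` any `{0, ±1}`-valued completely multiplicative function, with `s(p) = (1 + χ(p))/2`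
— the indicator of the split primes (`χ(p) = 1`), plus `1/2` at the ramified ones. [folklore] -/
structure IsNuType (ν : ArithmeticFunction ℝ) (s : ℕ → ℝ) : Prop where
  isMult : ν.IsMultiplicative
  nonneg : ∀ n, 0 ≤ ν n
  s_nonneg : ∀ p, 0 ≤ s p
  s_le_one : ∀ p, s p ≤ 1
  prime_le : ∀ p, p.Prime → ν p ≤ 2 * s p
  pow_le : ∀ p i : ℕ, p.Prime → ν (p ^ i) ≤ (i : ℝ) + 1

/-- A `ν`-type function is a block of degree `1`. [folklore] -/
theorem IsNuType.isBlock {ν : ArithmeticFunction ℝ} {s : ℕ → ℝ} (h : IsNuType ν s) : IsBlock ν 1 :=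
  ⟨h.isMult, h.nonneg, fun p i hp => by rw [pow_one]; exact h.pow_le p i hp⟩

/-- `ν(p) ≤ 2`. [folklore] -/
theorem IsNuType.prime_le_two {ν : ArithmeticFunction ℝ} {s : ℕ → ℝ} (h : IsNuType ν s) {p : ℕ}
    (hp : p.Prime) : ν p ≤ 2 := (h.prime_le p hp).trans (by linarith [h.s_le_one p])

/-- A function `χ : ℕ → ℝ` as a real arithmetic function (value `0` at `0`). [folklore] -/
def chiAF (χ : ℕ → ℝ) : ArithmeticFunction ℝ := ⟨fun n => if n = 0 then 0 else χ n, if_pos rfl⟩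

/-- `chiAF χ n = χ n` for `n ≠ 0`. [folklore] -/
theorem chiAF_apply_of_ne_zero (χ : ℕ → ℝ) {n : ℕ} (hn : n ≠ 0) : chiAF χ n = χ n := if_neg hn

/-- **`ν = 1 ∗ χ`**, the coefficients of `ζ(s)L(s,χ)` [p. 7: "Let ν(n) and υ(n) be given by
ζ(s)L(s,χ) = ∑_n ν(n)n^{-s}, …"], for a function `χ` on `ℕ`. [cite: Zhang2022LandauSiegel, §3 p. 7] -/
def nuChi (χ : ℕ → ℝ) : ArithmeticFunction ℝ :=
  chiAF χ * (ArithmeticFunction.zeta : ArithmeticFunction ℝ)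

/-- `ν(n) = ∑_{d ∣ n} χ(d)`. [folklore] -/
theorem nuChi_apply (χ : ℕ → ℝ) (n : ℕ) : nuChi χ n = ∑ d ∈ n.divisors, chiAF χ d := by
  rw [nuChi, coe_mul_zeta_apply]

section Chi

variable {χ : ℕ → ℝ}

/-- `chiAF χ` is multiplicative for `χ` (completely) multiplicative with `χ 1 = 1`. [folklore] -/
theorem isMultiplicative_chiAF (hχ1 : χ 1 = 1) (hχmul : ∀ m n, χ (m * n) = χ m * χ n) :
    (chiAF χ).IsMultiplicative := by
  rw [IsMultiplicative.iff_ne_zero]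
  refine ⟨by rw [chiAF_apply_of_ne_zero χ one_ne_zero, hχ1], fun {m n} hm hn _ => ?_⟩
  rw [chiAF_apply_of_ne_zero χ (mul_ne_zero hm hn), chiAF_apply_of_ne_zero χ hm,
    chiAF_apply_of_ne_zero χ hn, hχmul]

/-- `ν = 1 ∗ χ` is multiplicative. [folklore] -/
theorem isMultiplicative_nuChi (hχ1 : χ 1 = 1) (hχmul : ∀ m n, χ (m * n) = χ m * χ n) :
    (nuChi χ).IsMultiplicative :=
  (isMultiplicative_chiAF hχ1 hχmul).mul isMultiplicative_zeta.natCast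

/-- `χ(p^k) = χ(p)^k`. [folklore] -/
theorem chi_pow (hχ1 : χ 1 = 1) (hχmul : ∀ m n, χ (m * n) = χ m * χ n) (p k : ℕ) :
    χ (p ^ k) = χ p ^ k := by
  induction k with
  | zero => rw [pow_zero, pow_zero, hχ1]
  | succ k ih => rw [pow_succ, hχmul, ih, pow_succ]

/-- `ν(p^k) = ∑_{i ≤ k} χ(p)^i`. [folklore] -/
theorem nuChi_prime_pow (hχ1 : χ 1 = 1) (hχmul : ∀ m n, χ (m * n) = χ m * χ n) {p : ℕ}
    (hp : p.Prime) (k : ℕ) : nuChi χ (p ^ k) = ∑ i ∈ range (k + 1), χ p ^ i := by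
  rw [nuChi_apply, Nat.sum_divisors_prime_pow hp]
  exact sum_congr rfl fun i _ => by
    rw [chiAF_apply_of_ne_zero χ (pow_ne_zero i hp.ne_zero), chi_pow hχ1 hχmul]

/-- `ν(p) = 1 + χ(p)`. [folklore] -/
theorem nuChi_prime (hχ1 : χ 1 = 1) (hχmul : ∀ m n, χ (m * n) = χ m * χ n) {p : ℕ}
    (hp : p.Prime) : nuChi χ p = 1 + χ p := by
  have h := nuChi_prime_pow hχ1 hχmul hp 1
  rw [pow_one] at h
  rw [h, sum_range_succ, sum_range_one, pow_zero, pow_one]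

/-- The geometric sums of `−1, 0, 1` of length `k+1` lie in `[0, k+1]`. [folklore] -/
theorem geom_sum_mem_of_trichotomy {x : ℝ} (hx : x = -1 ∨ x = 0 ∨ x = 1) (k : ℕ) :
    0 ≤ ∑ i ∈ range (k + 1), x ^ i ∧ ∑ i ∈ range (k + 1), x ^ i ≤ (k : ℝ) + 1 := by
  have hk : (0 : ℝ) ≤ k := Nat.cast_nonneg k
  rcases hx with rfl | rfl | rfl
  · rw [neg_one_geom_sum]
    split_ifs
    · exact ⟨le_rfl, by linarith⟩
    · exact ⟨zero_le_one, by linarith⟩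
  · rw [sum_range_succ']
    simp only [pow_succ, mul_zero, sum_const_zero, pow_zero, zero_add]
    exact ⟨zero_le_one, by linarith⟩
  · simp only [one_pow, sum_const, card_range, nsmul_eq_mul, mul_one]
    push_cast
    exact ⟨by linarith, le_rfl⟩

/-- `ν ≥ 0` for `χ` with values in `{0, ±1}`: THE PLACE WHERE `χ` REAL IS USED (a multiplicative
function is nonnegative iff it is at prime powers, and `ν(p^k) = ∑_{i≤k} χ(p)^i ∈ {0, 1, k+1}`).
[cite: Zhang2022LandauSiegel, §3 (3.1) p. 7] -/
theorem nuChi_nonneg (hχ1 : χ 1 = 1) (hχmul : ∀ m n, χ (m * n) = χ m * χ n)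
    (hχval : ∀ n, χ n = -1 ∨ χ n = 0 ∨ χ n = 1) (n : ℕ) : 0 ≤ nuChi χ n := by
  rcases eq_or_ne n 0 with rfl | hn
  · simp
  · rw [(isMultiplicative_nuChi hχ1 hχmul).multiplicative_factorization _ hn, Finsupp.prod]
    refine prod_nonneg fun p hp => ?_
    have hp' : p.Prime := Nat.prime_of_mem_primeFactors (by rwa [Nat.support_factorization] at hp)
    rw [nuChi_prime_pow hχ1 hχmul hp']
    exact (geom_sum_mem_of_trichotomy (hχval p) _).1

/-- **CONSTRUCTION: `ν = 1 ∗ χ` is a `ν`-type function** with split density `s(p) = (1 + χ(p))/2`,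
for every `{0, ±1}`-valued completely multiplicative `χ` with `χ(1) = 1` (a real Dirichlet character
read on `ℕ`). In particular `ν(p) = 1 + χ(p) = 2` at split primes, `0` at inert ones, and
`0 ≤ ν(p^k) ≤ k + 1 = τ₂(p^k)` ((3.1) `ν ≤ τ₂` at prime powers). [cite: Zhang2022LandauSiegel, §3 (3.1) p. 7] -/
theorem isNuType_nuChi (hχ1 : χ 1 = 1) (hχmul : ∀ m n, χ (m * n) = χ m * χ n)
    (hχval : ∀ n, χ n = -1 ∨ χ n = 0 ∨ χ n = 1) :
    IsNuType (nuChi χ) (fun p => (1 + χ p) / 2) where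
  isMult := isMultiplicative_nuChi hχ1 hχmul
  nonneg := nuChi_nonneg hχ1 hχmul hχval
  s_nonneg p := by rcases hχval p with h | h | h <;> rw [h] <;> norm_num
  s_le_one p := by rcases hχval p with h | h | h <;> rw [h] <;> norm_num
  prime_le p hp := by rw [nuChi_prime hχ1 hχmul hp]; linarith
  pow_le p i hp := by
    rw [nuChi_prime_pow hχ1 hχmul hp]
    exact (geom_sum_mem_of_trichotomy (hχval p) i).2

end Chi

/-! #### The two prime inequalities behind the counts -/

/-- **The square of the nested piecewise majorant.** For `a, b, c ∈ {0,1}` with `c ≤ b ≤ a`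
(nesting `y₀ ≤ y₂ ≤ y₁` of the cutoffs), `0 ≤ s ≤ 1` and `0 ≤ x ≤ 2s` (a `ν`-type prime value):
`(2a + 2b + xc)² ≤ 4a + 12b + 20cs` — the source of the cell's counts of the shape
`4·e_P + (16 − 4)·e_T + (36 − 16)·s` (increments `(2+2)² − 2² = 12`, `(2+2+2)² − (2+2)² = 20`).
[folklore] -/
theorem nested_sq_le {a b c s x : ℝ} (ha : a = 0 ∨ a = 1) (hb : b = 0 ∨ b = 1)
    (hc : c = 0 ∨ c = 1) (hcb : c ≤ b) (hba : b ≤ a) (hs0 : 0 ≤ s) (hs1 : s ≤ 1) (hx0 : 0 ≤ x)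
    (hx : x ≤ 2 * s) : (2 * a + 2 * b + x * c) ^ 2 ≤ 4 * a + 12 * b + 20 * (c * s) := by
  have hx2 : x ≤ 2 := by linarith
  have hxx : x ^ 2 ≤ 4 * s := by
    nlinarith [mul_nonneg hx0 (sub_nonneg.2 hx), mul_nonneg hs0 (sub_nonneg.2 hx2)]
  rcases ha with rfl | rfl <;> rcases hb with rfl | rfl <;> rcases hc with rfl | rfl <;>
    nlinarith

/-- `(xc)² ≤ 4cs` for `c ∈ {0,1}`, `0 ≤ s ≤ 1`, `0 ≤ x ≤ 2s` (the `F²` count `(2ν(p))² ↦ 16s`).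
[folklore] -/
theorem sq_mul_cut_le {c s x : ℝ} (hc : c = 0 ∨ c = 1) (hs0 : 0 ≤ s) (hs1 : s ≤ 1)
    (hx0 : 0 ≤ x) (hx : x ≤ 2 * s) : (x * c) ^ 2 ≤ 4 * (c * s) := by
  have hx2 : x ≤ 2 := by linarith
  rcases hc with rfl | rfl
  · simp
  · nlinarith [mul_nonneg hx0 (sub_nonneg.2 hx), mul_nonneg hs0 (sub_nonneg.2 hx2)]

/-! ### Part 4. The blocks of §§15–17: shapes of the source's coefficient sequences -/

section Blocks

variable {ν : ArithmeticFunction ℝ} {s : ℕ → ℝ}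

/-- Block of `F(s,ψ) = ∑_{n≤D⁴} ν(n)ψ(n)n^{-s}` and of `G(s,ψ) = ∑_{n≤D⁴} υ(n)ψ(n)n^{-s}` [p. 7]
(`|υ| ≤ ν`, (3.1)): `ν · [y₀-smooth]` with `y₀ = D⁴`; prime value `ν(p)[p ≤ y₀] ≤ 2s(p)[p ≤ y₀]`.
[cite: Zhang2022LandauSiegel, §3 p. 7 (F, G, (3.1))] -/
def blockF (ν : ArithmeticFunction ℝ) (y₀ : ℕ) : ArithmeticFunction ℝ := ν.pmul (smoothIndLE y₀)

/-- `blockF ν y₀` is a block of degree `1`. [folklore] -/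
theorem isBlock_blockF (hν : IsNuType ν s) (y₀ : ℕ) : IsBlock (blockF ν y₀) 1 :=
  hν.isBlock.pmul_smoothIndLE y₀

/-- Prime value of `blockF`. [folklore] -/
theorem blockF_prime (ν : ArithmeticFunction ℝ) (y₀ : ℕ) {p : ℕ} (hp : p.Prime) :
    blockF ν y₀ p = ν p * cutInd y₀ p := pmul_smoothIndLE_prime ν hp

/-- SHAPE ⇒ DOMINATION for `F`, `G` and their unimodular twists: `|u(n)| ≤ C ν(n)` (`C ≥ 0`) and
`u(n) = 0` for `n > y₀` give `u ≪ C · blockF ν y₀`. [folklore] -/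
theorem dom_blockF (hν : IsNuType ν s) {u : ℕ → ℂ} {C : ℝ} {y₀ : ℕ} (hC : 0 ≤ C)
    (hu : ∀ n, ‖u n‖ ≤ C * ν n) (hus : ∀ n, y₀ < n → u n = 0) : Dom u C (blockF ν y₀) :=
  dom_pmul_smoothIndLE_of_support hC hν.nonneg (fun n _ => hu n) hus

/-- Block of `ϱ*(n) = ∑_{n = lm, l < D⁴} ν(l) κ̄₂(m)` [p. 35], the coefficients of
`(L(1−s+β₁,ψ̄)/L(1−s,ψ̄))·F(1−s,ψ̄)` at (17.7): `blockF ν y₀ ∗ |κ₂|`, degree `3`; prime value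
`ν(p)[p ≤ y₀] + |κ₂(p)|`. [cite: Zhang2022LandauSiegel, §17 p. 35 (ϱ*)] -/
def blockRho (ν : ArithmeticFunction ℝ) (y₀ : ℕ) (b₁ : ℝ) : ArithmeticFunction ℝ :=
  blockF ν y₀ * normAF (kappa₂ b₁)

/-- `blockRho` is a block of degree `3`. [folklore] -/
theorem isBlock_blockRho (hν : IsNuType ν s) (y₀ : ℕ) (b₁ : ℝ) : IsBlock (blockRho ν y₀ b₁) 3 :=
  (isBlock_blockF hν y₀).mul (isBlock_normAF_kappa₂ b₁)

/-- Prime value of `blockRho`. [folklore] -/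
theorem blockRho_prime (hν : IsNuType ν s) (y₀ : ℕ) (b₁ : ℝ) {p : ℕ} (hp : p.Prime) :
    blockRho ν y₀ b₁ p = ν p * cutInd y₀ p + ‖kappa₂ b₁ p‖ := by
  rw [blockRho, (isBlock_blockF hν y₀).mul_prime (isBlock_normAF_kappa₂ b₁) hp, blockF_prime ν y₀ hp,
    normAF_apply]

/-- SHAPE ⇒ DOMINATION for `ϱ*`: `u` of `F`-shape (`|u| ≤ Cν`, support `≤ y₀`) and `|k(n)| ≤ |κ₂(n)|`
(e.g. `k = κ̄₂`) give `u ⋆ k ≪ C · blockRho ν y₀ b₁`. [folklore] -/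
theorem dom_blockRho (hν : IsNuType ν s) {u k : ℕ → ℂ} {C : ℝ} {y₀ : ℕ} {b₁ : ℝ} (hC : 0 ≤ C)
    (hu : ∀ n, ‖u n‖ ≤ C * ν n) (hus : ∀ n, y₀ < n → u n = 0)
    (hk : ∀ n, ‖k n‖ ≤ ‖kappa₂ b₁ n‖) : Dom (seqConv u k) C (blockRho ν y₀ b₁) := by
  have h := dom_seqConv (dom_blockF hν hC hu hus) (dom_of_norm_le (dom_normAF (kappa₂ b₁)) hk)
  rwa [mul_one] at h

/-- Block of `Q = b ⋆ ν₁*`, `∑_n (b⋆ν₁*)(n)ψ(n)n^{-s} = B(s,ψ)G(s,ψ)N(s+β₂,ψ)N(s+β₃,ψ)` [p. 35] at (17.7):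
`(τ₂·[y_b-smooth]) ∗ blockF ν y₀ ∗ [y₂-smooth] ∗ [y₂-smooth]` (`b ≪ τ₂` supported on `n ≤ y_b`
(15.2); `G`; two factors `N`, bounded coefficients `g*(T²/n)n^{-β}` supported on `n ≤ y₂`), degree `6`;
prime value `2[p ≤ y_b] + ν(p)[p ≤ y₀] + 2[p ≤ y₂]`.
[cite: Zhang2022LandauSiegel, §17 p. 35 ((17.7)–(17.8)), §15 (15.1)–(15.2) p. 30, Lemma 6.1 p. 12] -/
def blockQ (ν : ArithmeticFunction ℝ) (yb y₀ y₂ : ℕ) : ArithmeticFunction ℝ :=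
  (tau 2).pmul (smoothIndLE yb) * blockF ν y₀ * smoothIndLE y₂ * smoothIndLE y₂

/-- `blockQ` is a block of degree `6`. [folklore] -/
theorem isBlock_blockQ (hν : IsNuType ν s) (yb y₀ y₂ : ℕ) : IsBlock (blockQ ν yb y₀ y₂) 6 :=
  ((((isBlock_tau 2).pmul_smoothIndLE yb).mul (isBlock_blockF hν y₀)).mul (isBlock_smoothIndLE y₂)).mul
    (isBlock_smoothIndLE y₂)

/-- Prime value of `blockQ`. [folklore] -/
theorem blockQ_prime (hν : IsNuType ν s) (yb y₀ y₂ : ℕ) {p : ℕ} (hp : p.Prime) :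
    blockQ ν yb y₀ y₂ p = 2 * cutInd yb p + ν p * cutInd y₀ p + cutInd y₂ p + cutInd y₂ p := by
  have h1 := (isBlock_tau 2).pmul_smoothIndLE yb
  have h2 := isBlock_blockF hν y₀
  have h3 := isBlock_smoothIndLE y₂
  rw [blockQ, ((h1.mul h2).mul h3).mul_prime h3 hp, (h1.mul h2).mul_prime h3 hp, h1.mul_prime h2 hp,
    pmul_smoothIndLE_prime _ hp, tau_prime 2 hp, blockF_prime ν y₀ hp, smoothIndLE_prime hp]
  push_cast; ring

/-- SHAPE ⇒ DOMINATION for `Q = b ⋆ g ⋆ w₁ ⋆ w₂`: `|b| ≤ C_b τ₂` supported on `n ≤ y_b`, `g` of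
`F`-shape with constant `C_G`, `|w_i| ≤ C_w` supported on `n ≤ y₂` (`C`'s `≥ 0`) give
`Q ≪ C_b C_G C_w² · blockQ ν y_b y₀ y₂`. [folklore] -/
theorem dom_blockQ (hν : IsNuType ν s) {b g w₁ w₂ : ℕ → ℂ} {Cb CG Cw : ℝ} (hCb : 0 ≤ Cb)
    (hCG : 0 ≤ CG) (hCw : 0 ≤ Cw) {yb y₀ y₂ : ℕ}
    (hb : ∀ n, n ≠ 0 → ‖b n‖ ≤ Cb * tau 2 n) (hbs : ∀ n, yb < n → b n = 0)
    (hg : ∀ n, ‖g n‖ ≤ CG * ν n) (hgs : ∀ n, y₀ < n → g n = 0)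
    (hw₁ : ∀ n, n ≠ 0 → ‖w₁ n‖ ≤ Cw) (hw₁s : ∀ n, y₂ < n → w₁ n = 0)
    (hw₂ : ∀ n, n ≠ 0 → ‖w₂ n‖ ≤ Cw) (hw₂s : ∀ n, y₂ < n → w₂ n = 0) :
    Dom (seqConv (seqConv (seqConv b g) w₁) w₂) (Cb * CG * Cw * Cw) (blockQ ν yb y₀ y₂) :=
  dom_seqConv (dom_seqConv (dom_seqConv
    (dom_pmul_smoothIndLE_of_support hCb (tau_nonneg 2) hb hbs) (dom_blockF hν hCG hg hgs))
    (dom_smoothIndLE_of_support hCw hw₁ hw₁s)) (dom_smoothIndLE_of_support hCw hw₂ hw₂s)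

/-- Block of `ν*` at (17.2) [p. 35: `ν*(n) = ∑_{n = n₁⋯n₆} κ₂(n₁) χ(n₂n₃)(𝔨₁(n₂) + ι₂𝔨₂(n₂))`
`(ῑ₃𝔨₃(n₃) + ῑ₄𝔨₄(n₃)) υ(n₄) g̃₂(n₅) g̃₃(n₆)`]: `|κ₂| ∗ [y₁-sm] ∗ [y₁-sm] ∗ blockF ν y₀ ∗ [y₂-sm] ∗ [y₂-sm]`
(two bounded factors supported on `n ≤ y₁` — the coefficients of `B`'s two factors `H₁₄ + ι₂H₁₂`,
`H₂` (12.2), of lengths `< P^{1/2} = y₁` —, `υ` supported on `n ≤ D⁴ = y₀`, two bounded factors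
supported on `n ≤ y₂ = 2T²` — the `N`'s), degree `7`;
prime value `|κ₂(p)| + 2[p ≤ y₁] + ν(p)[p ≤ y₀] + 2[p ≤ y₂]`.
[cite: Zhang2022LandauSiegel, §17 p. 35 (ν*), §12 (12.2) p. 24, Lemma 6.1 p. 12] -/
def blockNuStar (b₁ : ℝ) (ν : ArithmeticFunction ℝ) (y₁ y₀ y₂ : ℕ) : ArithmeticFunction ℝ :=
  normAF (kappa₂ b₁) * smoothIndLE y₁ * smoothIndLE y₁ * blockF ν y₀ * smoothIndLE y₂ * smoothIndLE y₂

/-- `blockNuStar` is a block of degree `7`. [folklore] -/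
theorem isBlock_blockNuStar (hν : IsNuType ν s) (b₁ : ℝ) (y₁ y₀ y₂ : ℕ) :
    IsBlock (blockNuStar b₁ ν y₁ y₀ y₂) 7 :=
  (((((isBlock_normAF_kappa₂ b₁).mul (isBlock_smoothIndLE y₁)).mul (isBlock_smoothIndLE y₁)).mul
    (isBlock_blockF hν y₀)).mul (isBlock_smoothIndLE y₂)).mul (isBlock_smoothIndLE y₂)

/-- Prime value of `blockNuStar`. [folklore] -/
theorem blockNuStar_prime (hν : IsNuType ν s) (b₁ : ℝ) (y₁ y₀ y₂ : ℕ) {p : ℕ} (hp : p.Prime) :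
    blockNuStar b₁ ν y₁ y₀ y₂ p =
      ‖kappa₂ b₁ p‖ + cutInd y₁ p + cutInd y₁ p + ν p * cutInd y₀ p + cutInd y₂ p + cutInd y₂ p := by
  have h1 := isBlock_normAF_kappa₂ b₁
  have h2 := isBlock_smoothIndLE y₁
  have h4 := isBlock_blockF hν y₀
  have h5 := isBlock_smoothIndLE y₂
  rw [blockNuStar, ((((h1.mul h2).mul h2).mul h4).mul h5).mul_prime h5 hp,
    (((h1.mul h2).mul h2).mul h4).mul_prime h5 hp, ((h1.mul h2).mul h2).mul_prime h4 hp,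
    (h1.mul h2).mul_prime h2 hp, h1.mul_prime h2 hp, normAF_apply, smoothIndLE_prime hp,
    smoothIndLE_prime hp, blockF_prime ν y₀ hp]

/-- SHAPE ⇒ DOMINATION for `ν* = k ⋆ v₂ ⋆ v₃ ⋆ g ⋆ w₅ ⋆ w₆`: `|k| ≤ |κ₂|`; `|v_i| ≤ C_v` supported on
`n ≤ y₁`; `g` of `F`-shape (constant `C_G`); `|w_i| ≤ C_w` supported on `n ≤ y₂` (`C`'s `≥ 0`) give
`ν* ≪ C_v² C_G C_w² · blockNuStar b₁ ν y₁ y₀ y₂`. [folklore] -/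
theorem dom_blockNuStar (hν : IsNuType ν s) {k v₂ v₃ g w₅ w₆ : ℕ → ℂ} {Cv CG Cw : ℝ}
    (hCv : 0 ≤ Cv) (hCG : 0 ≤ CG) (hCw : 0 ≤ Cw) {b₁ : ℝ} {y₁ y₀ y₂ : ℕ}
    (hk : ∀ n, ‖k n‖ ≤ ‖kappa₂ b₁ n‖)
    (hv₂ : ∀ n, n ≠ 0 → ‖v₂ n‖ ≤ Cv) (hv₂s : ∀ n, y₁ < n → v₂ n = 0)
    (hv₃ : ∀ n, n ≠ 0 → ‖v₃ n‖ ≤ Cv) (hv₃s : ∀ n, y₁ < n → v₃ n = 0)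
    (hg : ∀ n, ‖g n‖ ≤ CG * ν n) (hgs : ∀ n, y₀ < n → g n = 0)
    (hw₅ : ∀ n, n ≠ 0 → ‖w₅ n‖ ≤ Cw) (hw₅s : ∀ n, y₂ < n → w₅ n = 0)
    (hw₆ : ∀ n, n ≠ 0 → ‖w₆ n‖ ≤ Cw) (hw₆s : ∀ n, y₂ < n → w₆ n = 0) :
    Dom (seqConv (seqConv (seqConv (seqConv (seqConv k v₂) v₃) g) w₅) w₆)
      (Cv * Cv * CG * Cw * Cw) (blockNuStar b₁ ν y₁ y₀ y₂) := by
  have h := dom_seqConv (dom_seqConv (dom_seqConv (dom_seqConv (dom_seqConv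
    (dom_of_norm_le (dom_normAF (kappa₂ b₁)) hk) (dom_smoothIndLE_of_support hCv hv₂ hv₂s))
    (dom_smoothIndLE_of_support hCv hv₃ hv₃s)) (dom_blockF hν hCG hg hgs))
    (dom_smoothIndLE_of_support hCw hw₅ hw₅s)) (dom_smoothIndLE_of_support hCw hw₆ hw₆s)
  rwa [one_mul] at h

end Blocks

/-! ### Part 5. The mean squares at the three `Ψ₁ → Ψ` extension sites -/

/-- **(15.4), the `L`-ratio side: `k̃ = κ₁ ⋆ k` with `k ≪ 1`, exponent `4`.** For Zhang's `κ₁`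
(purely imaginary shifts `β_j = i b_j`) and ANY `k` with `|k(n)| ≤ C` (`n ≥ 1`) — in the source
`k(n) = n^{β₃}g*(P₄/n)`, the coefficients of `K(1−s−β₃,ψ̄)` [p. 12, p. 30] —, for `X ≥ 2`:
`∑_{m≤X} |(κ₁∗k)(m)|²/m ≤ C² · majorantConst 4 8 · exp(6(|b₁|+|b₂|) log 4X) · (log X)^4`
(`(|κ₁|∗τ₁)(p) = 1 + |κ₁(p)| ≤ 2 + (|b₁|+|b₂|) log p` and `≤ 4`; `sq_le_add` with `m = M = 2`). The
printed majorant `k̃ ≪ τ₄` [p. 30] counts `(log X)^{16}`; the cell's ALT-3 count at this site is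
`μ_M = 4e_P` (rows X-ALT3.15.04a/b). Nothing about the manuscript's (15.4) is asserted.
[cite: Zhang2022LandauSiegel, §15 (15.4) p. 30] -/
theorem sum_norm_kappa₁_conv_bounded_sq_div_le (b₁ b₂ : ℝ) {k : ℕ → ℂ} {C : ℝ}
    (hk : ∀ n, n ≠ 0 → ‖k n‖ ≤ C) {X : ℕ} (hX : 2 ≤ X) :
    ∑ m ∈ Icc 1 X, ‖conv (kappa₁ b₁ b₂) k m‖ ^ 2 / m ≤
      C ^ 2 * (majorantConst 4 8 * Real.exp (6 * (|b₁| + |b₂|) * Real.log (4 * X)) *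
        Real.log X ^ 4) := by
  have hκ := isMultiplicative_kappa₁ b₁ b₂
  have hG := isMultiplicative_absConvTau hκ 1
  have hk' : ∀ n, n ≠ 0 → ‖k n‖ ≤ C * tau 1 n := fun n hn => by
    rw [tau_one_apply hn, mul_one]; exact hk n hn
  have hB : 0 ≤ |b₁| + |b₂| := by positivity
  have key := sum_sq_div_le_gen (g := fun n => absConvTau (kappa₁ b₁ b₂) 1 n) (m := 2) (M := 2)
    hG.map_one (fun m n h => hG.map_mul_of_coprime h) (absConvTau_nonneg _ 1) hB
    (fun p hp => by
      rw [absConvTau_prime hκ 1 hp]; push_cast; linarith [norm_kappa₁_prime_le b₁ b₂ hp])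
    (fun p hp => by
      rw [absConvTau_prime hκ 1 hp]; push_cast; linarith [norm_kappa₁_prime_le_three b₁ b₂ hp])
    (fun p ν hp => absConvTau_prime_pow_le 1 hp (fun i => norm_kappa₁_prime_pow_le b₁ b₂ hp i) ν) hX
  refine (sum_norm_sq_div_le_of_le (fun m _ => norm_conv_le_of_le_tau hk' m) X).trans
    (mul_le_mul_of_nonneg_left (key.trans_eq ?_) (sq_nonneg _))
  norm_num

/-- **(15.4), the `B²` side: `b ⋆ b` with `b ≪ τ₂`, exponent `16`.** If `|b(n)| ≤ C τ₂(n)` (`n ≥ 1`,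
`C ≥ 0`; (15.2)) then for `X ≥ 2`, `∑_{n≤X} |(b⋆b)(n)|²/n ≤ C⁴ · majorantConst 16 8 · (log X)^{16}`
(`|b ⋆ b| ≤ C² τ₄`, `τ₄(p)² = 16`): the cell's `μ_{A²} = 16e_P` at (15.4) (rows X-ALT3.15.04a/b; no
cancellation is available in `B²`). [cite: Zhang2022LandauSiegel, §15 (15.1)–(15.2), (15.4) p. 30] -/
theorem sum_norm_seqConv_tau_two_sq_div_le {b : ℕ → ℂ} {C : ℝ} (hC : 0 ≤ C)
    (hb : ∀ n, n ≠ 0 → ‖b n‖ ≤ C * tau 2 n) {X : ℕ} (hX : 2 ≤ X) :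
    ∑ n ∈ Icc 1 X, ‖seqConv b b n‖ ^ 2 / n ≤ C ^ 4 * (majorantConst 16 8 * Real.log X ^ 16) := by
  have hpt : ∀ n, n ≠ 0 → ‖seqConv b b n‖ ≤ C * C * tau 4 n := fun n _ =>
    norm_seqConv_le_tau hC hb hb n
  have key := sum_tau_sq_div_le 4 hX
  calc ∑ n ∈ Icc 1 X, ‖seqConv b b n‖ ^ 2 / n ≤ (C * C) ^ 2 * ∑ n ∈ Icc 1 X, tau 4 n ^ 2 / n :=
        sum_norm_sq_div_le_of_le hpt X
    _ ≤ (C * C) ^ 2 * (majorantConst 16 8 * Real.log X ^ 16) :=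
        mul_le_mul_of_nonneg_left (key.trans_eq (by norm_num)) (sq_nonneg _)
    _ = _ := by ring

section Sites

variable {ν : ArithmeticFunction ℝ} {s : ℕ → ℝ}

/-- **(17.2), the `L`-ratio side: `ν*`, count `4[y₁] + 12[y₂] + 20·S`.** For a `ν`-type `ν` with
split density `s`, cutoffs `y₀ ≤ y₂ ≤ y₁` (`y₂ ≥ 2`; in the source `y₀ = D⁴`, `y₂ = 2T²`,
`y₁ = P^{1/2}` by (12.1), (2.21)) and ANY `u ≪ C · blockNuStar b₁ ν y₁ y₀ y₂` (e.g. `ν*`, by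
`dom_blockNuStar`),
for `X ≥ 2`: `∑_{n≤X} |u(n)|²/n ≤ C² · scaleBound 0 4 12 20 14 (14|b₁|) s y₀ y₁ y₂ X`, i.e.
`≪ C² e^{14|b₁| log 4X} e^{20 S(s;y₀,X)} (log y₁)^4 (log y₂)^{12}` — the cell's
`μ_M = 4e_P + 12e_T + 20·sSplit` at (17.2) (row X-ALT3.17.02a), versus the pointwise `ν* ≪ τ₈`,
`(log X)^{64}`. At `p`: `G(p) = |κ₂(p)| + 2a + 2b + ν(p)c` with `a = [p≤y₁]`, `b = [p≤y₂]`,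
`c = [p≤y₀]`; `nested_sq_le` and `sq_le_add` (`m = 2a+2b+ν(p)c ≤ 6`, `M = 2`, `u = |b₁| log p`).
Nothing about the manuscript's (17.2) is asserted. [cite: Zhang2022LandauSiegel, §17 (17.2) p. 35] -/
theorem sum_norm_sq_div_le_of_dom_blockNuStar (hν : IsNuType ν s) {u : ℕ → ℂ} {C : ℝ} {b₁ : ℝ}
    {y₁ y₀ y₂ : ℕ} (hy₀₂ : y₀ ≤ y₂) (hy₂₁ : y₂ ≤ y₁) (hy₂ : 2 ≤ y₂)
    (hu : Dom u C (blockNuStar b₁ ν y₁ y₀ y₂)) {X : ℕ} (hX : 2 ≤ X) :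
    ∑ n ∈ Icc 1 X, ‖u n‖ ^ 2 / n ≤ C ^ 2 * scaleBound 0 4 12 20 14 (14 * |b₁|) s y₀ y₁ y₂ X := by
  have hy₁ : 2 ≤ y₁ := hy₂.trans hy₂₁
  refine sum_norm_sq_div_le_of_dom hu (isBlock_blockNuStar hν b₁ y₁ y₀ y₂)
    (by positivity : (0 : ℝ) ≤ 14 * |b₁|) hy₁ hy₂ (fun p hp => ?_) hX
  rw [blockNuStar_prime hν b₁ y₁ y₀ y₂ hp]
  have ha := cutInd_zero_or_one y₁ p
  have hb := cutInd_zero_or_one y₂ p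
  have hc := cutInd_zero_or_one y₀ p
  have hcb := cutInd_mono hy₀₂ p
  have hba := cutInd_mono hy₂₁ p
  have hs0 := hν.s_nonneg p
  have hs1 := hν.s_le_one p
  have hx0 := hν.nonneg p
  have hx := hν.prime_le p hp
  have hk0 : 0 ≤ ‖kappa₂ b₁ p‖ := norm_nonneg _
  have hk2 := norm_kappa₂_prime_le_two b₁ hp
  have hkB := norm_kappa₂_prime_le b₁ hp
  have hlog : 0 ≤ Real.log p := Real.log_nonneg (by exact_mod_cast hp.one_lt.le)
  have hu0 : 0 ≤ |b₁| * Real.log p := by positivity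
  have ha0 := cutInd_nonneg y₁ p
  have hb0 := cutInd_nonneg y₂ p
  have ha1 := cutInd_le_one y₁ p
  have hb1 := cutInd_le_one y₂ p
  have hxc0 : 0 ≤ ν p * cutInd y₀ p := mul_nonneg hx0 (cutInd_nonneg y₀ p)
  have hxc : ν p * cutInd y₀ p ≤ 2 :=
    (mul_le_of_le_one_right hx0 (cutInd_le_one _ _)).trans (hν.prime_le_two hp)
  have h0 := nested_sq_le ha hb hc hcb hba hs0 hs1 hx0 hx
  have hsq := sq_le_add (t := 2 * cutInd y₁ p + 2 * cutInd y₂ p + ν p * cutInd y₀ p + ‖kappa₂ b₁ p‖)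
    (m := 2 * cutInd y₁ p + 2 * cutInd y₂ p + ν p * cutInd y₀ p) (M := 2) (u := |b₁| * Real.log p)
    (by linarith) (by linarith) (by norm_num) hu0 (by linarith) (by linarith)
  have h14 : (2 * (2 * cutInd y₁ p + 2 * cutInd y₂ p + ν p * cutInd y₀ p) + 2) *
      (|b₁| * Real.log p) ≤ 14 * (|b₁| * Real.log p) :=
    mul_le_mul_of_nonneg_right (by linarith) hu0
  have e : (‖kappa₂ b₁ p‖ + cutInd y₁ p + cutInd y₁ p + ν p * cutInd y₀ p + cutInd y₂ p +
      cutInd y₂ p) ^ 2 =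
      (2 * cutInd y₁ p + 2 * cutInd y₂ p + ν p * cutInd y₀ p + ‖kappa₂ b₁ p‖) ^ 2 := by ring
  push_cast
  rw [e]
  linarith

/-- **(17.2), the `F²` side: count `16·S`.** For `u ≪ C · blockF ν y₀` (e.g. the coefficients of
`F(1−s,ψ̄)`: `|ν(n)ψ̄(n)n^{…}| = ν(n)`, `n ≤ D⁴ = y₀`), for `X ≥ 2`:
`∑_{n≤X} |(u⋆u)(n)|²/n ≤ C⁴ · majorantConst 0 6 · exp(16·S(s;y₀,X))` (`(2ν(p)c)² ≤ 16cs`,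
`sq_mul_cut_le`): the cell's `μ = (2ν(p))² = 16` at split `p ≤ D⁴`, i.e. `16·sSplit` (row X-ALT3.17.02a).
[cite: Zhang2022LandauSiegel, §17 (17.2)–(17.3) p. 35, §3 p. 7] -/
theorem sum_norm_seqConv_sq_div_le_of_dom_blockF (hν : IsNuType ν s) {u : ℕ → ℂ} {C : ℝ}
    {y₀ : ℕ} (hu : Dom u C (blockF ν y₀)) {X : ℕ} (hX : 2 ≤ X) :
    ∑ n ∈ Icc 1 X, ‖seqConv u u n‖ ^ 2 / n ≤
      C ^ 4 * (majorantConst 0 6 * Real.exp (16 * splitSum s y₀ X)) := by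
  have hB := isBlock_blockF hν y₀
  have key := sum_norm_sq_div_le_of_dom (dom_seqConv hu hu) (hB.mul hB) (e₀ := 0) (e₁ := 0)
    (e₂ := 0) (c := 16) (K := 0) (s := s) (y₀ := y₀) le_rfl (le_refl 2) (le_refl 2)
    (fun p hp => by
      rw [hB.mul_prime hB hp, blockF_prime ν y₀ hp]
      have h := sq_mul_cut_le (cutInd_zero_or_one y₀ p) (hν.s_nonneg p) (hν.s_le_one p)
        (hν.nonneg p) (hν.prime_le p hp)
      have e : (ν p * cutInd y₀ p + ν p * cutInd y₀ p) ^ 2 = 4 * (ν p * cutInd y₀ p) ^ 2 := by ring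
      push_cast
      rw [e]
      linarith) hX
  refine key.trans_eq ?_
  simp only [scaleBound, pow_zero, mul_one, zero_mul, Real.exp_zero, add_zero]
  push_cast
  ring

/-- **(17.7), the `L`-ratio side in the text's order: `ϱ*`, count `4·S`.** For
`u ≪ C · blockRho ν y₀ b₁` (e.g. `ϱ* = (ν·1_{<D⁴}) ⋆ κ̄₂`, by `dom_blockRho`), for `X ≥ 2`:
`∑_{n≤X} |u(n)|²/n ≤ C² · majorantConst 0 6 · exp(6|b₁| log 4X) · exp(4·S(s;y₀,X))`
(`G(p) = ν(p)c + |κ₂(p)|`; `sq_mul_cut_le`, `sq_le_add` with `m = ν(p)c ≤ 2`, `M = 2`): the cell's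
`μ_X = 4·sSplit` at (17.7) (row X-ALT3.17.07a), versus the pointwise `ϱ* ≪ τ₄`, `(log X)^{16}`.
Nothing about the manuscript's (17.7) is asserted. [cite: Zhang2022LandauSiegel, §17 (17.7)–(17.8) p. 35] -/
theorem sum_norm_sq_div_le_of_dom_blockRho (hν : IsNuType ν s) {u : ℕ → ℂ} {C : ℝ} {y₀ : ℕ}
    {b₁ : ℝ} (hu : Dom u C (blockRho ν y₀ b₁)) {X : ℕ} (hX : 2 ≤ X) :
    ∑ n ∈ Icc 1 X, ‖u n‖ ^ 2 / n ≤
      C ^ 2 * (majorantConst 0 6 * Real.exp (6 * |b₁| * Real.log (4 * X)) *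
        Real.exp (4 * splitSum s y₀ X)) := by
  have key := sum_norm_sq_div_le_of_dom hu (isBlock_blockRho hν y₀ b₁) (e₀ := 0) (e₁ := 0)
    (e₂ := 0) (c := 4) (K := 6 * |b₁|) (s := s) (y₀ := y₀) (by positivity) (le_refl 2) (le_refl 2)
    (fun p hp => by
      rw [blockRho_prime hν y₀ b₁ hp]
      have hx0 := hν.nonneg p
      have hk0 : 0 ≤ ‖kappa₂ b₁ p‖ := norm_nonneg _
      have hk2 := norm_kappa₂_prime_le_two b₁ hp
      have hkB := norm_kappa₂_prime_le b₁ hp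
      have hlog : 0 ≤ Real.log p := Real.log_nonneg (by exact_mod_cast hp.one_lt.le)
      have hu0 : 0 ≤ |b₁| * Real.log p := by positivity
      have hxc0 : 0 ≤ ν p * cutInd y₀ p := mul_nonneg hx0 (cutInd_nonneg y₀ p)
      have hxc : ν p * cutInd y₀ p ≤ 2 :=
        (mul_le_of_le_one_right hx0 (cutInd_le_one _ _)).trans (hν.prime_le_two hp)
      have h := sq_mul_cut_le (cutInd_zero_or_one y₀ p) (hν.s_nonneg p) (hν.s_le_one p) hx0
        (hν.prime_le p hp)
      have hsq := sq_le_add (t := ν p * cutInd y₀ p + ‖kappa₂ b₁ p‖) (m := ν p * cutInd y₀ p)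
        (M := 2) (u := |b₁| * Real.log p) (by linarith) hxc0 (by norm_num) hu0 (by linarith)
        (by linarith)
      have h6 : (2 * (ν p * cutInd y₀ p) + 2) * (|b₁| * Real.log p) ≤ 6 * (|b₁| * Real.log p) :=
        mul_le_mul_of_nonneg_right (by linarith) hu0
      push_cast
      linarith) hX
  refine key.trans_eq ?_
  simp only [scaleBound, pow_zero, mul_one, add_zero]
  push_cast
  ring

/-- **(17.7), the `L`-ratio side squared (the alternative order of steps): `ϱ* ⋆ ϱ*`, count
`16·S`.** For `u ≪ C · blockRho ν y₀ b₁`, for `X ≥ 2`: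
`∑_{n≤X} |(u⋆u)(n)|²/n ≤ C⁴ · majorantConst 0 14 · exp(24|b₁| log 4X) · exp(16·S(s;y₀,X))`
(`(2ν(p)c + 2|κ₂(p)|)²`: `sq_le_add` with `m = 2ν(p)c ≤ 4`, `M = 4`, `u = 2|b₁| log p`): the cell's
`μ = 16·sSplit` "X̃² long, with the κ₂-cancellation" at (17.7) (row X-ALT3.17.07b).
[cite: Zhang2022LandauSiegel, §17 (17.7)–(17.8) p. 35] -/
theorem sum_norm_seqConv_sq_div_le_of_dom_blockRho (hν : IsNuType ν s) {u : ℕ → ℂ} {C : ℝ}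
    {y₀ : ℕ} {b₁ : ℝ} (hu : Dom u C (blockRho ν y₀ b₁)) {X : ℕ} (hX : 2 ≤ X) :
    ∑ n ∈ Icc 1 X, ‖seqConv u u n‖ ^ 2 / n ≤
      C ^ 4 * (majorantConst 0 14 * Real.exp (24 * |b₁| * Real.log (4 * X)) *
        Real.exp (16 * splitSum s y₀ X)) := by
  have hB := isBlock_blockRho hν y₀ b₁
  have key := sum_norm_sq_div_le_of_dom (dom_seqConv hu hu) (hB.mul hB) (e₀ := 0) (e₁ := 0)
    (e₂ := 0) (c := 16) (K := 24 * |b₁|) (s := s) (y₀ := y₀) (by positivity) (le_refl 2)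
    (le_refl 2)
    (fun p hp => by
      rw [hB.mul_prime hB hp, blockRho_prime hν y₀ b₁ hp]
      have hx0 := hν.nonneg p
      have hk0 : 0 ≤ ‖kappa₂ b₁ p‖ := norm_nonneg _
      have hk2 := norm_kappa₂_prime_le_two b₁ hp
      have hkB := norm_kappa₂_prime_le b₁ hp
      have hlog : 0 ≤ Real.log p := Real.log_nonneg (by exact_mod_cast hp.one_lt.le)
      have hu0 : 0 ≤ |b₁| * Real.log p := by positivity
      have hxc0 : 0 ≤ ν p * cutInd y₀ p := mul_nonneg hx0 (cutInd_nonneg y₀ p)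
      have hxc : ν p * cutInd y₀ p ≤ 2 :=
        (mul_le_of_le_one_right hx0 (cutInd_le_one _ _)).trans (hν.prime_le_two hp)
      have h := sq_mul_cut_le (cutInd_zero_or_one y₀ p) (hν.s_nonneg p) (hν.s_le_one p) hx0
        (hν.prime_le p hp)
      have hsq := sq_le_add (t := 2 * (ν p * cutInd y₀ p) + 2 * ‖kappa₂ b₁ p‖)
        (m := 2 * (ν p * cutInd y₀ p)) (M := 4) (u := 2 * (|b₁| * Real.log p)) (by linarith)
        (by linarith) (by norm_num) (by linarith) (by linarith) (by linarith)
      have h24 : (2 * (2 * (ν p * cutInd y₀ p)) + 4) * (2 * (|b₁| * Real.log p)) ≤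
          24 * (|b₁| * Real.log p) := by nlinarith
      have e : (ν p * cutInd y₀ p + ‖kappa₂ b₁ p‖ + (ν p * cutInd y₀ p + ‖kappa₂ b₁ p‖)) ^ 2 =
          (2 * (ν p * cutInd y₀ p) + 2 * ‖kappa₂ b₁ p‖) ^ 2 := by ring
      push_cast
      rw [e]
      nlinarith) hX
  refine key.trans_eq ?_
  simp only [scaleBound, pow_zero, mul_one, add_zero]
  push_cast
  ring

/-- **(17.7), the `Q = b ⋆ ν₁*` side: count `4[y_b] + 12[y₂] + 20·S`.** For a `ν`-type `ν`, cutoffs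
`y₀ ≤ y₂ ≤ y_b` (`y₂ ≥ 2`; in the source `y₀ = D⁴`, `y₂ = 2T²`, `y_b = PT^{-2}η₊`, the support of
`b` (15.2)) and ANY `u ≪ C · blockQ ν y_b y₀ y₂` (e.g. `Q`, by `dom_blockQ`), for `X ≥ 2`:
`∑_{n≤X} |u(n)|²/n ≤ C² · scaleBound 0 4 12 20 12 0 s y₀ y_b y₂ X` (`G(p) = 2a + ν(p)c + 2b`,
`nested_sq_le`): the cell's `μ_Q = 4e_P + 12e_T + 20·sSplit` at (17.7) (row X-ALT3.17.07b), versus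
the pointwise `Q ≪ τ₆`, `(log X)^{36}`. [cite: Zhang2022LandauSiegel, §17 (17.7)–(17.8) p. 35] -/
theorem sum_norm_sq_div_le_of_dom_blockQ (hν : IsNuType ν s) {u : ℕ → ℂ} {C : ℝ}
    {yb y₀ y₂ : ℕ} (hy₀₂ : y₀ ≤ y₂) (hy₂b : y₂ ≤ yb) (hy₂ : 2 ≤ y₂)
    (hu : Dom u C (blockQ ν yb y₀ y₂)) {X : ℕ} (hX : 2 ≤ X) :
    ∑ n ∈ Icc 1 X, ‖u n‖ ^ 2 / n ≤ C ^ 2 * scaleBound 0 4 12 20 12 0 s y₀ yb y₂ X := by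
  have hyb : 2 ≤ yb := hy₂.trans hy₂b
  refine sum_norm_sq_div_le_of_dom hu (isBlock_blockQ hν yb y₀ y₂) le_rfl hyb hy₂
    (fun p hp => ?_) hX
  rw [blockQ_prime hν yb y₀ y₂ hp]
  have h0 := nested_sq_le (cutInd_zero_or_one yb p) (cutInd_zero_or_one y₂ p)
    (cutInd_zero_or_one y₀ p) (cutInd_mono hy₀₂ p) (cutInd_mono hy₂b p) (hν.s_nonneg p)
    (hν.s_le_one p) (hν.nonneg p) (hν.prime_le p hp)
  have e : (2 * cutInd yb p + ν p * cutInd y₀ p + cutInd y₂ p + cutInd y₂ p) ^ 2 =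
      (2 * cutInd yb p + 2 * cutInd y₂ p + ν p * cutInd y₀ p) ^ 2 := by ring
  push_cast
  rw [e]
  linarith

/-- **(17.7), the `Q²` side in the text's order: `Q ⋆ Q`, count `16[y_b] + 48[y₂] + 80·S`.** For
`u ≪ C · blockQ ν y_b y₀ y₂` (cutoffs as above), for `X ≥ 2`:
`∑_{n≤X} |(u⋆u)(n)|²/n ≤ C⁴ · scaleBound 0 16 48 80 26 0 s y₀ y_b y₂ X` (`(2G(p))² = 4G(p)²`): the
cell's `μ_{Q²} = 16e_P + 48e_T + 80·sSplit` at (17.7) (row X-ALT3.17.07a), versus the pointwise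
`Q² ≪ τ₁₂`, `(log X)^{144}`. [cite: Zhang2022LandauSiegel, §17 (17.7)–(17.8) p. 35] -/
theorem sum_norm_seqConv_sq_div_le_of_dom_blockQ (hν : IsNuType ν s) {u : ℕ → ℂ} {C : ℝ}
    {yb y₀ y₂ : ℕ} (hy₀₂ : y₀ ≤ y₂) (hy₂b : y₂ ≤ yb) (hy₂ : 2 ≤ y₂)
    (hu : Dom u C (blockQ ν yb y₀ y₂)) {X : ℕ} (hX : 2 ≤ X) :
    ∑ n ∈ Icc 1 X, ‖seqConv u u n‖ ^ 2 / n ≤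
      C ^ 4 * scaleBound 0 16 48 80 26 0 s y₀ yb y₂ X := by
  have hyb : 2 ≤ yb := hy₂.trans hy₂b
  have hB := isBlock_blockQ hν yb y₀ y₂
  have key := sum_norm_sq_div_le_of_dom (dom_seqConv hu hu) (hB.mul hB) (e₀ := 0) (e₁ := 16)
    (e₂ := 48) (c := 80) (K := 0) (s := s) (y₀ := y₀) le_rfl hyb hy₂
    (fun p hp => by
      rw [hB.mul_prime hB hp, blockQ_prime hν yb y₀ y₂ hp]
      have h0 := nested_sq_le (cutInd_zero_or_one yb p) (cutInd_zero_or_one y₂ p)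
        (cutInd_zero_or_one y₀ p) (cutInd_mono hy₀₂ p) (cutInd_mono hy₂b p) (hν.s_nonneg p)
        (hν.s_le_one p) (hν.nonneg p) (hν.prime_le p hp)
      have e : (2 * cutInd yb p + ν p * cutInd y₀ p + cutInd y₂ p + cutInd y₂ p +
          (2 * cutInd yb p + ν p * cutInd y₀ p + cutInd y₂ p + cutInd y₂ p)) ^ 2 =
          4 * (2 * cutInd yb p + 2 * cutInd y₂ p + ν p * cutInd y₀ p) ^ 2 := by ring
      push_cast
      rw [e]
      linarith) hX
  calc _ ≤ _ := key
    _ = _ := by ring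

end Sites

end Literature.NumberTheory.LFunctions.Zhang2022.MeanSquareMajorant
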